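import Summits.ValiantsHypothesis.ValiantsHypothesis.Theorems.NewtonUnitEquationsTwoProductsPermutationTypeFamily
import Summits.ValiantsHypothesis.ValiantsHypothesis.Theorems.NewtonUnitEquationsTwoProductsFormalLogLinearisationLiftedPencilCountBound

/-!
# Route NewtonUnitEquations — crux `TwoProducts` (stmt-ValiantsHypothesis-5906), line `relation_ladder`, rung R6 (four-term
# rank one): the SEGRE LIFT — the PROVED SPLIT `BinExpPencilCount → RankOneFourLaw`

val-idea-8 g3 (ideator; lens decomp), 2026-08-28. `lean check` rc 0, **0 sorries**; turnkey Theorems-portable (namespace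
`…Theorems.NewtonUnitEquations.TwoProducts.PermutationType`, imports two LANDED Theorems modules only); engine memo =
`Cruxes/TwoProducts/Lines/relation_ladder_R6_engine.md` rev 3; tool interface = `Lines/relation_ladder_R6_tool.lean` rev 2
(`R6Tool.BinExpPencilCount`, copied VERBATIM below as `PermutationType.BinExpPencilCount`; val-lit-p3 g14's closing theorem
`…FormalLogLinearisation.BinExpSum.binExpPencilCount` (A = 3) proved in scratch 09:16Z, landing as F1–F3).

## What is proved (sorry-free)

* `RankOneCoincidences A ρ⁺ ρ⁻` (verbatim the R6 sketch's): all additive coincidences of the letter family `A` are, on letter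
  multisets, multiples of the one relation `ρ⁺ ~ ρ⁻`.
* `RankOneFourLaw` **(R6)**: `∃ c, ∀ m u v` (constant terms `0`), if for some pairwise DISTINCT `α β γ δ` with `α + β = γ + δ`
  the family `j ↦ supp u_j ∪ supp v_j` has `RankOneCoincidences _ (e_γ + e_δ) (e_α + e_β)`, then GLOBALLY
  `#visible ≤ 2^{c m} (#T + 2)^c` — the same shape as R3♯ `PermTypeLaw` (which is the case `k = 0`,
  `rankOneCoincidences_of_permType`).
* `rankOneFourLaw_of_binExpPencilCount : BinExpPencilCount → RankOneFourLaw` — THE SPLIT. Ingredients, all here and proved: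
  (T1) toric push-forwards `phiT/piT` (`Y_i ↦ Y^{M i}`) and their composition; (T2–T3) the Segre substitution `segM` of a
  four-index datum (`Y_a ↦ Y_aY_c, Y_b ↦ Y_bY_d, Y_c ↦ Y_aY_d, Y_d ↦ Y_bY_c`), balanced exponents, the fibre
  parametrisation `Lof`/`KR` and `multinomial_Lof`; (T4) the tool copy, the slice terms `termC/termA/termD`, the slice sum
  `Fsl = bsum …` and THE COEFFICIENT THEOREM `coeff_segre_logTrunc` (coefficient of `Y^x` in the Segre lift of the truncated
  logarithm = `(-1)^{n+1}/n · multinomial(x̂) · F_{x_c}(x̂)`), support criterion, shape lemma, width `≤ 2m(b+1)^3`;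
  (T5) Lemma A for ANY toric lift (`toric_minLog`, from the tree's generic `strictMin_sub_iff_of_congr` +
  `coeff_wronskian_congr`); (T6) the planar instance: refined push-forward `E'` (`ℕ²`-Riesz: `α⊓γ, β⊓δ, α-α⊓γ, γ-α⊓γ`),
  `phi E' ∘ phiT segM = phi enum`, `phi E' GT = tailDiff`, INJECTIVITY of `piE E'` on `supp GT` from rank-one coincidences,
  the upstairs weights `θ` (strictly positive for valid `ξ`; `θ(segM i) = -wt ξ (enum i)`), the slice identity;
  (T7) per visible point: `x̂₀` is a zero-avoiding strict pencil-minimiser of the slice functional on `{F_b ≠ 0} ⊆ ℕ^s`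
  (competitors of degree `> R` handled by `deg ≤ lwt`), the injective key `l ↦ (b, x̂₀)` with `b ≤ m`, fibrewise tool
  count, the arithmetic `(m+1)(s+2)^A(N+2)^{A(log₂(N+2)+1)} ≤ 2^{(212A+13)m}(s+2)^{212A+13}` (`N = 2m(m+1)^3`), and the
  degenerate case (a relation letter outside the alphabet ⇒ `PermType` ⇒ R3♯ `permTypeLaw_proof`).

Honest scope: shapes `α = β + γ` (R6b), `2β = α + γ` (R6c) and coincidence rank `≥ 2` (R7) are NOT covered and go to the
residual of skeleton v14. Nothing here moves VP ≠ VNP; `TwoProducts` (5906) stays OPEN. [folklore]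
-/

noncomputable section

set_option linter.dupNamespace false
set_option linter.unusedSimpArgs false
set_option linter.deprecated false

namespace Summit.ValiantsHypothesis.ValiantsHypothesis.Theorems.NewtonUnitEquations.TwoProducts.PermutationType
open scoped BigOperators
open MvPolynomial

variable {σ : Type*} [Fintype σ] [DecidableEq σ]

/-! ## Part T1: monomial substitutions `Y_i ↦ Y^{M i}` between polynomial rings (the toric push-forward) -/

section Toric
variable {τ : Type*} [Fintype τ] [DecidableEq τ] (M : σ → (τ →₀ ℕ))

/-- The monomial substitution `Y_i ↦ Y^{M i}`. [folklore] -/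
def phiT : MvPolynomial σ ℂ →ₐ[ℂ] MvPolynomial τ ℂ :=
  aeval fun i => (monomial (M i) (1 : ℂ) : MvPolynomial τ ℂ)

/-- The induced map on exponents. [folklore] -/
def piT (κ : σ →₀ ℕ) : τ →₀ ℕ := κ.sum fun i k => k • M i

omit [Fintype τ] [DecidableEq τ] [DecidableEq σ] in
/-- `piT` as a sum over the index type. [folklore] -/
theorem piT_eq_sum (κ : σ →₀ ℕ) : piT M κ = ∑ i, κ i • M i := by
  unfold piT; exact Finsupp.sum_fintype _ _ (fun _ => by simp)

omit [Fintype σ] [DecidableEq σ] [Fintype τ] [DecidableEq τ] in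
/-- `piT` is the `ℕ`-linear extension of `M`. [folklore] -/
theorem piT_eq_linearCombination (κ : σ →₀ ℕ) : piT M κ = Finsupp.linearCombination ℕ M κ :=
  (Finsupp.linearCombination_apply ℕ κ).symm

omit [Fintype σ] [DecidableEq σ] [Fintype τ] [DecidableEq τ] in
/-- Additivity of `piT`. [folklore] -/
theorem piT_add (κ κ' : σ →₀ ℕ) : piT M (κ + κ') = piT M κ + piT M κ' := by
  simp only [piT_eq_linearCombination, map_add]

omit [Fintype σ] [DecidableEq σ] [Fintype τ] [DecidableEq τ] in
/-- `piT` of a multiple. [folklore] -/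
theorem piT_nsmul (k : ℕ) (κ : σ →₀ ℕ) : piT M (k • κ) = k • piT M κ := by
  simp only [piT_eq_linearCombination, map_nsmul]

omit [Fintype σ] [DecidableEq σ] [Fintype τ] [DecidableEq τ] in
/-- `piT` of a single letter. [folklore] -/
theorem piT_single (i : σ) (k : ℕ) : piT M (Finsupp.single i k) = k • M i := by
  unfold piT; rw [Finsupp.sum_single_index]; exact zero_smul _ _

omit [Fintype σ] [DecidableEq σ] [Fintype τ] [DecidableEq τ] in
/-- `phiT` on monomials. [folklore] -/
theorem phiT_monomial (κ : σ →₀ ℕ) (a : ℂ) : phiT M (monomial κ a) = monomial (piT M κ) a := by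
  unfold phiT piT
  rw [aeval_monomial, monomial_finsupp_sum_index, MvPolynomial.algebraMap_eq]
  congr 1
  refine Finsupp.prod_congr fun i _ => ?_
  rw [monomial_pow, one_pow]

omit [Fintype σ] [DecidableEq σ] [Fintype τ] [DecidableEq τ] in
/-- `phiT` on a variable. [folklore] -/
theorem phiT_X (i : σ) : phiT M (X i) = monomial (M i) 1 := by
  rw [show (X i : MvPolynomial σ ℂ) = monomial (Finsupp.single i 1) 1 from rfl, phiT_monomial, piT_single, one_smul]

omit [Fintype σ] [DecidableEq σ] [Fintype τ] [DecidableEq τ] in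
/-- `phiT` as a sum over the support. [folklore] -/
theorem phiT_eq_sum (H : MvPolynomial σ ℂ) : phiT M H = ∑ κ ∈ H.support, monomial (piT M κ) (coeff κ H) := by
  conv_lhs => rw [as_sum H]
  rw [map_sum]
  exact Finset.sum_congr rfl fun κ _ => phiT_monomial M κ _

omit [Fintype σ] [DecidableEq σ] [Fintype τ] in
/-- Coefficients of a push-forward are fibre sums. [folklore] -/
theorem coeff_phiT (H : MvPolynomial σ ℂ) (x : τ →₀ ℕ) :
    coeff x (phiT M H) = ∑ κ ∈ H.support with piT M κ = x, coeff κ H := by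
  classical
  rw [phiT_eq_sum, coeff_sum, Finset.sum_filter]
  refine Finset.sum_congr rfl fun κ _ => ?_
  rw [coeff_monomial]

omit [Fintype σ] [DecidableEq σ] [Fintype τ] in
/-- A support point of a push-forward has a preimage in the support. [folklore] -/
theorem exists_of_mem_support_phiT (H : MvPolynomial σ ℂ) (x : τ →₀ ℕ) (hx : x ∈ (phiT M H).support) :
    ∃ κ ∈ H.support, piT M κ = x := by
  classical
  rw [mem_support_iff, coeff_phiT] at hx
  obtain ⟨κ, hκ, -⟩ := Finset.exists_ne_zero_of_sum_ne_zero hx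
  exact ⟨κ, (Finset.mem_filter.mp hκ).1, (Finset.mem_filter.mp hκ).2⟩

omit [Fintype σ] [DecidableEq σ] [Fintype τ] [DecidableEq τ] in
/-- The planar push-forward `phi` is the case `τ = Fin 2` of `phiT`. [folklore] -/
theorem phi_eq_phiT (E : σ → (Fin 2 →₀ ℕ)) : phi E = phiT E := rfl

omit [Fintype σ] [DecidableEq σ] [Fintype τ] [DecidableEq τ] in
/-- `piE` is the case `τ = Fin 2` of `piT`. [folklore] -/
theorem piE_eq_piT (E : σ → (Fin 2 →₀ ℕ)) (κ : σ →₀ ℕ) : piE E κ = piT E κ := rfl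

omit [Fintype σ] [DecidableEq σ] [Fintype τ] [DecidableEq τ] in
/-- Composition of monomial substitutions on exponents. [folklore] -/
theorem piT_piT {υ : Type*} (N : τ → (υ →₀ ℕ)) (κ : σ →₀ ℕ) :
    piT N (piT M κ) = piT (fun i => piT N (M i)) κ := by
  simp only [piT_eq_linearCombination]
  rw [← LinearMap.comp_apply]
  congr 1
  ext i
  simp [Finsupp.linearCombination_single]

omit [Fintype σ] [DecidableEq σ] [Fintype τ] [DecidableEq τ] in
/-- Composition of monomial substitutions on polynomials. [folklore] -/
theorem phiT_phiT {υ : Type*} (N : τ → (υ →₀ ℕ)) (H : MvPolynomial σ ℂ) :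
    phiT N (phiT M H) = phiT (fun i => piT N (M i)) H := by
  have : (phiT N).comp (phiT M) = phiT (fun i => piT N (M i)) := by
    refine algHom_ext fun i => ?_
    rw [AlgHom.comp_apply, phiT_X, phiT_monomial, phiT_X]
  rw [← AlgHom.comp_apply, this]

end Toric

/-! ## Part T2: the four-term relation data and the Segre substitution
`α ↦ Y_a Y_c`, `β ↦ Y_b Y_d`, `γ ↦ Y_a Y_d`, `δ ↦ Y_b Y_c`, other letters unchanged -/

/-- Four distinct indices (of the relation letters `α, β, γ, δ`). [folklore] -/
structure FourIdx (σ : Type*) where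
  /-- index of `α` (upstairs: `Z₁`) -/
  a : σ
  /-- index of `β` (upstairs: `Z₂`) -/
  b : σ
  /-- index of `γ` (upstairs: `W₁`) -/
  c : σ
  /-- index of `δ` (upstairs: `W₂`) -/
  d : σ
  hab : a ≠ b
  hac : a ≠ c
  had : a ≠ d
  hbc : b ≠ c
  hbd : b ≠ d
  hcd : c ≠ d

variable (I : FourIdx σ)

/-- The Segre substitution on letters. [folklore] -/
def segM (i : σ) : σ →₀ ℕ :=
  if i = I.a then Finsupp.single I.a 1 + Finsupp.single I.c 1
  else if i = I.b then Finsupp.single I.b 1 + Finsupp.single I.d 1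
  else if i = I.c then Finsupp.single I.a 1 + Finsupp.single I.d 1
  else if i = I.d then Finsupp.single I.b 1 + Finsupp.single I.c 1
  else Finsupp.single i 1

omit [Fintype σ] in
theorem segM_a : segM I I.a = Finsupp.single I.a 1 + Finsupp.single I.c 1 := by
  unfold segM; rw [if_pos rfl]

omit [Fintype σ] in
theorem segM_b : segM I I.b = Finsupp.single I.b 1 + Finsupp.single I.d 1 := by
  unfold segM; rw [if_neg I.hab.symm, if_pos rfl]

omit [Fintype σ] in
theorem segM_c : segM I I.c = Finsupp.single I.a 1 + Finsupp.single I.d 1 := by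
  unfold segM; rw [if_neg I.hac.symm, if_neg I.hbc.symm, if_pos rfl]

omit [Fintype σ] in
theorem segM_d : segM I I.d = Finsupp.single I.b 1 + Finsupp.single I.c 1 := by
  unfold segM; rw [if_neg I.had.symm, if_neg I.hbd.symm, if_neg I.hcd.symm, if_pos rfl]

omit [Fintype σ] in
theorem segM_other (i : σ) (ha : i ≠ I.a) (hb : i ≠ I.b) (hc : i ≠ I.c) (hd : i ≠ I.d) :
    segM I i = Finsupp.single i 1 := by
  unfold segM; rw [if_neg ha, if_neg hb, if_neg hc, if_neg hd]

omit [Fintype σ] in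
/-- The Segre substitution identifies the two sides of the relation: `M α + M β = M γ + M δ`. [folklore] -/
theorem segM_rel : segM I I.a + segM I I.b = segM I I.c + segM I I.d := by
  rw [segM_a, segM_b, segM_c, segM_d]; abel

omit [Fintype σ] in
/-- Every `segM i` is nonzero. [folklore] -/
theorem segM_ne_zero (i : σ) : segM I i ≠ 0 := by
  unfold segM
  split_ifs <;> intro h
  · have := DFunLike.congr_fun h I.a; simp [I.hac.symm] at this
  · have := DFunLike.congr_fun h I.b; simp [I.hbd.symm] at this
  · have := DFunLike.congr_fun h I.a; simp [I.had.symm] at this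
  · have := DFunLike.congr_fun h I.b; simp [I.hbc.symm] at this
  · have := DFunLike.congr_fun h i; simp at this

omit [DecidableEq σ] in
/-- Coordinates of a toric image, as a sum. [folklore] -/
theorem piT_apply {τ : Type*} (M : σ → (τ →₀ ℕ)) (L : σ →₀ ℕ) (j : τ) :
    piT M L j = ∑ i, L i * (M i) j := by
  rw [piT_eq_sum, Finsupp.coe_finset_sum, Finset.sum_apply]
  simp only [Finsupp.coe_smul, Pi.smul_apply, smul_eq_mul]

/-- `Z₁`-coordinate of a toric image: `#α + #γ`. [folklore] -/
theorem piT_segM_a (L : σ →₀ ℕ) : piT (segM I) L I.a = L I.a + L I.c := by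
  have F := And.intro I.hab (And.intro I.hac (And.intro I.had (And.intro I.hbc (And.intro I.hbd I.hcd))))
  rw [piT_apply]
  have key : ∀ i, L i * (segM I i) I.a = (if i = I.a then L i else 0) + (if i = I.c then L i else 0) := by
    intro i
    unfold segM
    split_ifs with h1 h2 h3 h4 <;>
      simp [Finsupp.single_apply, h1, F.1, F.2.1, F.2.2.1, F.2.2.2.1, F.2.2.2.2.1, F.2.2.2.2.2,
        F.1.symm, F.2.1.symm, F.2.2.1.symm, F.2.2.2.1.symm, F.2.2.2.2.1.symm, F.2.2.2.2.2.symm] <;> simp_all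
  simp only [key, Finset.sum_add_distrib, Finset.sum_ite_eq', Finset.mem_univ, if_true]

/-- `Z₂`-coordinate of a toric image: `#β + #δ`. [folklore] -/
theorem piT_segM_b (L : σ →₀ ℕ) : piT (segM I) L I.b = L I.b + L I.d := by
  have F := And.intro I.hab (And.intro I.hac (And.intro I.had (And.intro I.hbc (And.intro I.hbd I.hcd))))
  rw [piT_apply]
  have key : ∀ i, L i * (segM I i) I.b = (if i = I.b then L i else 0) + (if i = I.d then L i else 0) := by
    intro i
    unfold segM
    split_ifs with h1 h2 h3 h4 <;>
      simp [Finsupp.single_apply, F.1, F.2.1, F.2.2.1, F.2.2.2.1, F.2.2.2.2.1, F.2.2.2.2.2,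
        F.1.symm, F.2.1.symm, F.2.2.1.symm, F.2.2.2.1.symm, F.2.2.2.2.1.symm, F.2.2.2.2.2.symm] <;> simp_all
  simp only [key, Finset.sum_add_distrib, Finset.sum_ite_eq', Finset.mem_univ, if_true]

/-- `W₁`-coordinate of a toric image: `#α + #δ`. [folklore] -/
theorem piT_segM_c (L : σ →₀ ℕ) : piT (segM I) L I.c = L I.a + L I.d := by
  have F := And.intro I.hab (And.intro I.hac (And.intro I.had (And.intro I.hbc (And.intro I.hbd I.hcd))))
  rw [piT_apply]
  have key : ∀ i, L i * (segM I i) I.c = (if i = I.a then L i else 0) + (if i = I.d then L i else 0) := by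
    intro i
    unfold segM
    split_ifs with h1 h2 h3 h4 <;>
      simp [Finsupp.single_apply, F.1, F.2.1, F.2.2.1, F.2.2.2.1, F.2.2.2.2.1, F.2.2.2.2.2,
        F.1.symm, F.2.1.symm, F.2.2.1.symm, F.2.2.2.1.symm, F.2.2.2.2.1.symm, F.2.2.2.2.2.symm] <;> simp_all
  simp only [key, Finset.sum_add_distrib, Finset.sum_ite_eq', Finset.mem_univ, if_true]

/-- `W₂`-coordinate of a toric image: `#β + #γ`. [folklore] -/
theorem piT_segM_d (L : σ →₀ ℕ) : piT (segM I) L I.d = L I.b + L I.c := by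
  have F := And.intro I.hab (And.intro I.hac (And.intro I.had (And.intro I.hbc (And.intro I.hbd I.hcd))))
  rw [piT_apply]
  have key : ∀ i, L i * (segM I i) I.d = (if i = I.b then L i else 0) + (if i = I.c then L i else 0) := by
    intro i
    unfold segM
    split_ifs with h1 h2 h3 h4 <;>
      simp [Finsupp.single_apply, F.1, F.2.1, F.2.2.1, F.2.2.2.1, F.2.2.2.2.1, F.2.2.2.2.2,
        F.1.symm, F.2.1.symm, F.2.2.1.symm, F.2.2.2.1.symm, F.2.2.2.2.1.symm, F.2.2.2.2.2.symm] <;> simp_all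
  simp only [key, Finset.sum_add_distrib, Finset.sum_ite_eq', Finset.mem_univ, if_true]

/-- Other coordinates of a toric image are unchanged. [folklore] -/
theorem piT_segM_other (L : σ →₀ ℕ) (j : σ) (ha : j ≠ I.a) (hb : j ≠ I.b) (hc : j ≠ I.c) (hd : j ≠ I.d) :
    piT (segM I) L j = L j := by
  have F := And.intro I.hab (And.intro I.hac (And.intro I.had (And.intro I.hbc (And.intro I.hbd I.hcd))))
  rw [piT_apply]
  have key : ∀ i, L i * (segM I i) j = (if i = j then L i else 0) := by
    intro i
    unfold segM
    split_ifs with h1 h2 h3 h4 <;>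
      simp [Finsupp.single_apply, ha, hb, hc, hd, Ne.symm ha, Ne.symm hb, Ne.symm hc, Ne.symm hd,
        F.1, F.2.1, F.2.2.1, F.2.2.2.1, F.2.2.2.2.1, F.2.2.2.2.2,
        F.1.symm, F.2.1.symm, F.2.2.1.symm, F.2.2.2.1.symm, F.2.2.2.2.1.symm, F.2.2.2.2.2.symm] <;> simp_all
  simp only [key]
  rw [Finset.sum_ite_eq']; simp


/-! ## Part T3: the four special coordinates, balanced exponents, and the fibres of the Segre substitution -/

/-- The four relation indices as a finset. [folklore] -/
def fourSet : Finset σ := {I.a, I.b, I.c, I.d}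

/-- The remaining indices. [folklore] -/
def rest : Finset σ := Finset.univ \ fourSet I

theorem mem_rest (j : σ) : j ∈ rest I ↔ j ≠ I.a ∧ j ≠ I.b ∧ j ≠ I.c ∧ j ≠ I.d := by
  classical
  unfold rest fourSet
  simp only [Finset.mem_sdiff, Finset.mem_univ, true_and, Finset.mem_insert, Finset.mem_singleton, not_or]

/-- Splitting a product over `σ` into the four relation coordinates and the rest. [folklore] -/
theorem prod_four_split {β : Type*} [CommMonoid β] (f : σ → β) :
    ∏ j, f j = (∏ j ∈ rest I, f j) * (f I.a * (f I.b * (f I.c * f I.d))) := by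
  classical
  unfold rest fourSet
  rw [← Finset.prod_sdiff (Finset.subset_univ ({I.a, I.b, I.c, I.d} : Finset σ))]
  congr 1
  rw [Finset.prod_insert (by simp [I.hab, I.hac, I.had]), Finset.prod_insert (by simp [I.hbc, I.hbd]),
    Finset.prod_pair I.hcd]

/-- Splitting a sum over `σ` into the four relation coordinates and the rest. [folklore] -/
theorem sum_four_split {β : Type*} [AddCommMonoid β] (f : σ → β) :
    ∑ j, f j = (∑ j ∈ rest I, f j) + (f I.a + (f I.b + (f I.c + f I.d))) := by
  classical
  unfold rest fourSet
  rw [← Finset.sum_sdiff (Finset.subset_univ ({I.a, I.b, I.c, I.d} : Finset σ))]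
  congr 1
  rw [Finset.sum_insert (by simp [I.hab, I.hac, I.had]), Finset.sum_insert (by simp [I.hbc, I.hbd]),
    Finset.sum_pair I.hcd]

/-- A finitely supported function from its table of values (`σ` is finite). [folklore] -/
def ofFun (f : σ → ℕ) : σ →₀ ℕ := Finsupp.equivFunOnFinite.symm f

@[simp] theorem ofFun_apply (f : σ → ℕ) (j : σ) : ofFun f j = f j := by
  simp [ofFun]

/-- Balanced exponents: `Z`-degree = `W`-degree, i.e. `x a + x b = x c + x d`. [folklore] -/
def Balanced (x : σ →₀ ℕ) : Prop := x I.a + x I.b = x I.c + x I.d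

/-- Toric images are balanced. [folklore] -/
theorem balanced_piT (L : σ →₀ ℕ) : Balanced I (piT (segM I) L) := by
  unfold Balanced
  rw [piT_segM_a, piT_segM_b, piT_segM_c, piT_segM_d]; ring

/-- The reduced exponent `x̂`: the coordinates `c, d` (`W₁, W₂`) set to zero. [folklore] -/
def xhat (x : σ →₀ ℕ) : σ →₀ ℕ := ofFun fun j => if j = I.c ∨ j = I.d then 0 else x j

theorem xhat_a (x : σ →₀ ℕ) : xhat I x I.a = x I.a := by
  classical simp [xhat, I.hac, I.had]

theorem xhat_b (x : σ →₀ ℕ) : xhat I x I.b = x I.b := by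
  classical simp [xhat, I.hbc, I.hbd]

theorem xhat_c (x : σ →₀ ℕ) : xhat I x I.c = 0 := by
  classical simp [xhat]

theorem xhat_d (x : σ →₀ ℕ) : xhat I x I.d = 0 := by
  classical simp [xhat]

theorem xhat_other (x : σ →₀ ℕ) (j : σ) (hc : j ≠ I.c) (hd : j ≠ I.d) : xhat I x j = x j := by
  classical simp [xhat, hc, hd]

/-- The letter multiset in the fibre of the Segre substitution over `x` with `#α = k`:
`#α = k, #β = x b + k - x c, #γ = x a - k, #δ = x c - k`, other letters as in `x`. [folklore] -/
def Lof (x : σ →₀ ℕ) (k : ℕ) : σ →₀ ℕ :=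
  ofFun fun j => if j = I.a then k else if j = I.b then x I.b + k - x I.c
    else if j = I.c then x I.a - k else if j = I.d then x I.c - k else x j

theorem Lof_a (x : σ →₀ ℕ) (k : ℕ) : Lof I x k I.a = k := by
  classical simp [Lof]

theorem Lof_b (x : σ →₀ ℕ) (k : ℕ) : Lof I x k I.b = x I.b + k - x I.c := by
  classical simp [Lof, I.hab.symm]

theorem Lof_c (x : σ →₀ ℕ) (k : ℕ) : Lof I x k I.c = x I.a - k := by
  classical simp [Lof, I.hac.symm, I.hbc.symm]

theorem Lof_d (x : σ →₀ ℕ) (k : ℕ) : Lof I x k I.d = x I.c - k := by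
  classical simp [Lof, I.had.symm, I.hbd.symm, I.hcd.symm]

theorem Lof_other (x : σ →₀ ℕ) (k : ℕ) (j : σ) (ha : j ≠ I.a) (hb : j ≠ I.b) (hc : j ≠ I.c) (hd : j ≠ I.d) :
    Lof I x k j = x j := by
  classical simp [Lof, ha, hb, hc, hd]

/-- The admissible range of `k = #α` in the fibre over `x`. [folklore] -/
def KR (x : σ →₀ ℕ) : Finset ℕ := Finset.Icc (x I.c - x I.b) (min (x I.a) (x I.c))

omit [Fintype σ] [DecidableEq σ] in
theorem mem_KR (x : σ →₀ ℕ) (k : ℕ) : k ∈ KR I x ↔ x I.c ≤ x I.b + k ∧ k ≤ x I.a ∧ k ≤ x I.c := by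
  unfold KR; rw [Finset.mem_Icc, le_min_iff]; omega

/-- (F1) Every preimage of `x` is an `Lof x k` with `k` admissible. [folklore] -/
theorem eq_Lof_of_piT (L x : σ →₀ ℕ) (h : piT (segM I) L = x) : L I.a ∈ KR I x ∧ L = Lof I x (L I.a) := by
  have ha := piT_segM_a I L; have hb := piT_segM_b I L; have hc := piT_segM_c I L; have hd := piT_segM_d I L
  rw [h] at ha hb hc hd
  refine ⟨(mem_KR I x _).2 ⟨by omega, by omega, by omega⟩, ?_⟩
  ext j
  by_cases hja : j = I.a
  · subst hja; rw [Lof_a]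
  by_cases hjb : j = I.b
  · subst hjb; rw [Lof_b]; omega
  by_cases hjc : j = I.c
  · subst hjc; rw [Lof_c]; omega
  by_cases hjd : j = I.d
  · subst hjd; rw [Lof_d]; omega
  rw [Lof_other I x _ j hja hjb hjc hjd, ← h, piT_segM_other I L j hja hjb hjc hjd]

/-- (F2) Every admissible `Lof x k` lies in the fibre over a balanced `x`. [folklore] -/
theorem piT_Lof (x : σ →₀ ℕ) (hx : Balanced I x) (k : ℕ) (hk : k ∈ KR I x) : piT (segM I) (Lof I x k) = x := by
  rw [mem_KR] at hk
  unfold Balanced at hx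
  ext j
  by_cases hja : j = I.a
  · subst hja; rw [piT_segM_a, Lof_a, Lof_c]; omega
  by_cases hjb : j = I.b
  · subst hjb; rw [piT_segM_b, Lof_b, Lof_d]; omega
  by_cases hjc : j = I.c
  · subst hjc; rw [piT_segM_c, Lof_a, Lof_d]; omega
  by_cases hjd : j = I.d
  · subst hjd; rw [piT_segM_d, Lof_b, Lof_c]; omega
  rw [piT_segM_other I _ j hja hjb hjc hjd, Lof_other I x k j hja hjb hjc hjd]

/-- (F4) The degree is constant along the fibre: `deg (Lof x k) = deg x̂`. [folklore] -/
theorem deg_Lof (x : σ →₀ ℕ) (k : ℕ) (hk : k ∈ KR I x) : deg (Lof I x k) = deg (xhat I x) := by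
  rw [mem_KR] at hk
  rw [deg_eq_sum, deg_eq_sum, sum_four_split I, sum_four_split I, Lof_a, Lof_b, Lof_c, Lof_d, xhat_a, xhat_b, xhat_c,
    xhat_d]
  have : ∑ j ∈ rest I, (Lof I x k) j = ∑ j ∈ rest I, (xhat I x) j := by
    refine Finset.sum_congr rfl fun j hj => ?_
    rw [mem_rest] at hj
    rw [Lof_other I x k j hj.1 hj.2.1 hj.2.2.1 hj.2.2.2, xhat_other I x j hj.2.2.1 hj.2.2.2]
  rw [this]; omega

/-- The degree of the reduced exponent. [folklore] -/
theorem deg_xhat (x : σ →₀ ℕ) : deg (xhat I x) = (∑ j ∈ rest I, x j) + (x I.a + x I.b) := by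
  rw [deg_eq_sum, sum_four_split I, xhat_a, xhat_b, xhat_c, xhat_d, add_zero, add_zero]
  congr 1
  refine Finset.sum_congr rfl fun j hj => ?_
  rw [mem_rest] at hj
  rw [xhat_other I x j hj.2.2.1 hj.2.2.2]

/-- The full degree of a balanced exponent in terms of the reduced one. [folklore] -/
theorem deg_eq_deg_xhat_add (x : σ →₀ ℕ) : deg x = deg (xhat I x) + (x I.c + x I.d) := by
  rw [deg_xhat, deg_eq_sum, sum_four_split I]; ring

/-- Multinomial coefficients over the whole (finite) index type. [folklore] -/
theorem multinomial_univ (f : σ →₀ ℕ) : f.multinomial = Nat.multinomial Finset.univ f := by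
  classical
  rw [Finsupp.multinomial_eq]
  unfold Nat.multinomial
  rw [Finset.sum_subset (Finset.subset_univ _) (fun j _ hj => by simpa using hj),
    Finset.prod_subset (Finset.subset_univ _) (fun j _ hj => by
      rw [Finsupp.notMem_support_iff.mp hj, Nat.factorial_zero])]

/-- (F5) Multinomial regrouping along the fibre:
`n!/(k! (x_b+k-x_c)! (x_a-k)! (x_c-k)! M!) = n!/(x_a! x_b! M!) · C(x_a, k) · C(x_b, x_c - k)`. [folklore] -/
theorem multinomial_Lof (x : σ →₀ ℕ) (k : ℕ) (hk : k ∈ KR I x) :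
    (Lof I x k).multinomial = (xhat I x).multinomial * ((x I.a).choose k * (x I.b).choose (x I.c - k)) := by
  have hk' := (mem_KR I x k).1 hk
  have hdeg := deg_Lof I x k hk
  rw [deg_eq_sum, deg_eq_sum] at hdeg
  have sL := Nat.multinomial_spec (Finset.univ : Finset σ) (Lof I x k)
  have sX := Nat.multinomial_spec (Finset.univ : Finset σ) (xhat I x)
  rw [← multinomial_univ] at sL sX
  rw [hdeg, ← sX] at sL
  -- the factorial identity
  have P : (∏ j, ((Lof I x k) j).factorial) * ((x I.a).choose k * (x I.b).choose (x I.c - k)) =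
      ∏ j, ((xhat I x) j).factorial := by
    rw [prod_four_split I, prod_four_split I, Lof_a, Lof_b, Lof_c, Lof_d, xhat_a, xhat_b, xhat_c, xhat_d]
    have hr : ∏ j ∈ rest I, ((Lof I x k) j).factorial = ∏ j ∈ rest I, ((xhat I x) j).factorial := by
      refine Finset.prod_congr rfl fun j hj => ?_
      rw [mem_rest] at hj
      rw [Lof_other I x k j hj.1 hj.2.1 hj.2.2.1 hj.2.2.2, xhat_other I x j hj.2.2.1 hj.2.2.2]
    rw [hr, Nat.factorial_zero, mul_one]
    have h1 : (x I.a).choose k * k.factorial * (x I.a - k).factorial = (x I.a).factorial :=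
      Nat.choose_mul_factorial_mul_factorial hk'.2.1
    have h2 : (x I.b).choose (x I.c - k) * (x I.c - k).factorial * (x I.b - (x I.c - k)).factorial =
        (x I.b).factorial := Nat.choose_mul_factorial_mul_factorial (by omega)
    have h3 : x I.b + k - x I.c = x I.b - (x I.c - k) := by omega
    rw [h3, ← h1, ← h2]; ring
  have hpos : 0 < ∏ j, ((Lof I x k) j).factorial := Finset.prod_pos fun j _ => Nat.factorial_pos _
  apply Nat.eq_of_mul_eq_mul_left hpos
  rw [sL, ← P]; ring


/-! ## Part T4: binomial characters, the tool interface `BinExpPencilCount` (verbatim copy of the interface of record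
`Cruxes/TwoProducts/Lines/relation_ladder_R6_tool.lean :: R6Tool.BinExpPencilCount`), and the slice sums -/

/-- The binomial character `ν ↦ C(ν, d) · a ^ (ν - d)` (verbatim copy of `R6Tool.binChar`). [folklore] -/
def binChar (a : ℂ) (d ν : ℕ) : ℂ := (Nat.choose ν d : ℂ) * a ^ (ν - d)

omit [Fintype σ] [DecidableEq σ] in
theorem binChar_zero_deg (a : ℂ) (ν : ℕ) : binChar a 0 ν = a ^ ν := by
  simp [binChar]

omit [Fintype σ] [DecidableEq σ] in
theorem binChar_base_zero (d ν : ℕ) : binChar 0 d ν = if ν = d then 1 else 0 := by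
  unfold binChar
  rcases lt_trichotomy ν d with h | rfl | h
  · simp [Nat.choose_eq_zero_of_lt h, h.ne]
  · simp
  · rw [if_neg h.ne', zero_pow (Nat.sub_ne_zero_of_lt h), mul_zero]

omit [Fintype σ] [DecidableEq σ] in
theorem binChar_eq_zero_of_lt (a : ℂ) (d ν : ℕ) (h : ν < d) : binChar a d ν = 0 := by
  simp [binChar, Nat.choose_eq_zero_of_lt h]

/-- **The R6 tool interface** (VERBATIM copy of `R6Tool.BinExpPencilCount`, rev 2 @373df2daad08; to be discharged BY NAME by
val-lit-p3's `…FormalLogLinearisation.BinExpSum.binExpPencilCount`): strict pencil-minimisers of a signed binomial-exponential sum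
on `ℕ^s` number at most quasi-polynomially many in the width `N = Σ_k ∏_i (d_{k i} + 1)`. [folklore] -/
def BinExpPencilCount : Prop :=
  ∃ A : ℕ, ∀ (s n : ℕ) (c : Fin n → ℂ) (a : Fin n → Fin s → ℂ) (d : Fin n → Fin s → ℕ) (u v : Fin s → ℝ)
    (S : Finset (Fin s → ℕ)),
    (∀ μ ∈ S, (∑ k, c k * ∏ i, ((μ i).choose (d k i) : ℂ) * a k i ^ (μ i - d k i)) ≠ 0 ∧
      ∃ t : ℝ, ∀ ν : Fin s → ℕ, ν ≠ μ →
        (∑ k, c k * ∏ i, ((ν i).choose (d k i) : ℂ) * a k i ^ (ν i - d k i)) ≠ 0 →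
        ∑ i, (u i + t * v i) * (μ i : ℝ) < ∑ i, (u i + t * v i) * (ν i : ℝ)) →
    S.card ≤ (s + 2) ^ A *
      (∑ k, ∏ i, (d k i + 1) + 2) ^ (A * (Nat.log 2 (∑ k, ∏ i, (d k i + 1) + 2) + 1))

/-- A signed binomial-exponential sum with term set `κ` on `ℕ^σ`. [folklore] -/
def bsum {κ : Type*} [Fintype κ] (C : κ → ℂ) (a : κ → σ → ℂ) (d : κ → σ → ℕ) (ν : σ → ℕ) : ℂ :=
  ∑ k, C k * ∏ i, binChar (a k i) (d k i) (ν i)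

/-- The binomial width `N = Σ_k ∏_i (d_{k i} + 1)`. [folklore] -/
def bwidth {κ : Type*} [Fintype κ] (d : κ → σ → ℕ) : ℕ := ∑ k, ∏ i, (d k i + 1)

omit [DecidableEq σ] in
/-- Monotonicity of the tool's bound in the width. [folklore] -/
theorem toolBound_mono (s A : ℕ) {N N' : ℕ} (h : N ≤ N') :
    (s + 2) ^ A * (N + 2) ^ (A * (Nat.log 2 (N + 2) + 1)) ≤ (s + 2) ^ A * (N' + 2) ^ (A * (Nat.log 2 (N' + 2) + 1)) := by
  refine Nat.mul_le_mul_left _ ?_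
  calc (N + 2) ^ (A * (Nat.log 2 (N + 2) + 1)) ≤ (N' + 2) ^ (A * (Nat.log 2 (N + 2) + 1)) :=
        Nat.pow_le_pow_left (by omega) _
    _ ≤ (N' + 2) ^ (A * (Nat.log 2 (N' + 2) + 1)) :=
        Nat.pow_le_pow_right (by omega) (Nat.mul_le_mul_left _ (by
          have := Nat.log_mono_right (b := 2) (show N + 2 ≤ N' + 2 by omega); omega))

/-- The tool for an arbitrary finite term set (transport along `Fintype.equivFin`). [folklore] -/
theorem binExpPencilCount_fintype (hT : BinExpPencilCount) :
    ∃ A : ℕ, ∀ (s : ℕ) (κ : Type) [Fintype κ] (C : κ → ℂ) (a : κ → Fin s → ℂ) (d : κ → Fin s → ℕ)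
      (u v : Fin s → ℝ) (S : Finset (Fin s → ℕ)),
      (∀ μ ∈ S, bsum C a d μ ≠ 0 ∧ ∃ t : ℝ, ∀ ν : Fin s → ℕ, ν ≠ μ → bsum C a d ν ≠ 0 →
        ∑ i, (u i + t * v i) * (μ i : ℝ) < ∑ i, (u i + t * v i) * (ν i : ℝ)) →
      S.card ≤ (s + 2) ^ A * (bwidth d + 2) ^ (A * (Nat.log 2 (bwidth d + 2) + 1)) := by
  obtain ⟨A, hA⟩ := hT
  refine ⟨A, fun s κ _ C a d u v S hS => ?_⟩
  set e := Fintype.equivFin κ with he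
  have hsum : ∀ ν : Fin s → ℕ,
      (∑ k : Fin (Fintype.card κ), C (e.symm k) * ∏ i, ((ν i).choose (d (e.symm k) i) : ℂ) *
        a (e.symm k) i ^ (ν i - d (e.symm k) i)) = bsum C a d ν := fun ν => by
    unfold bsum binChar
    exact Equiv.sum_comp e.symm (fun k => C k * ∏ i, (((ν i).choose (d k i) : ℂ) * a k i ^ (ν i - d k i)))
  have hw : (∑ k : Fin (Fintype.card κ), ∏ i, (d (e.symm k) i + 1)) = bwidth d := by
    unfold bwidth
    exact Equiv.sum_comp e.symm (fun k => ∏ i, (d k i + 1))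
  have := hA s (Fintype.card κ) (fun k => C (e.symm k)) (fun k => a (e.symm k)) (fun k => d (e.symm k)) u v S
    (fun μ hμ => by
      obtain ⟨h1, t, ht⟩ := hS μ hμ
      refine ⟨by rw [hsum]; exact h1, t, fun ν hne hν => ht ν hne (by rw [← hsum]; exact hν)⟩)
  rw [hw] at this
  exact this

section Slice
variable {m : ℕ}

/-- The slice term set: (signed atom, `k = #α`) with `k ≤ b`. [folklore] -/
abbrev SIdx (m b : ℕ) := (Fin m ⊕ Fin m) × Fin (b + 1)

/-- The coefficient table of a signed atom. [folklore] -/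
def tab (c d : Fin m → σ → ℂ) : Fin m ⊕ Fin m → σ → ℂ := Sum.elim c d

/-- The sign of a signed atom. [folklore] -/
def sgn (m : ℕ) : Fin m ⊕ Fin m → ℂ := Sum.elim (fun _ => 1) (fun _ => -1)

/-- Term coefficients of the slice sum: `± c_α^k c_δ^{b-k}`. [folklore] -/
def termC (c d : Fin m → σ → ℂ) (b : ℕ) : SIdx m b → ℂ :=
  fun τ => sgn m τ.1 * (tab c d τ.1 I.a ^ (τ.2 : ℕ) * tab c d τ.1 I.d ^ (b - τ.2))

/-- Term bases of the slice sum: `c_γ` on `Z₁`, `c_β` on `Z₂`, `0` on `W₁, W₂`, `c_e` elsewhere. [folklore] -/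
def termA (c d : Fin m → σ → ℂ) (b : ℕ) : SIdx m b → σ → ℂ :=
  fun τ j => if j = I.a then tab c d τ.1 I.c else if j = I.c ∨ j = I.d then 0 else tab c d τ.1 j

/-- Term binomial degrees of the slice sum: `k` on `Z₁`, `b - k` on `Z₂`, `0` elsewhere. [folklore] -/
def termD (b : ℕ) : SIdx m b → σ → ℕ :=
  fun τ j => if j = I.a then (τ.2 : ℕ) else if j = I.b then b - τ.2 else 0

/-- **The slice sum** `F(b; ·)` of the Segre-lifted truncated logarithm. [folklore] -/
def Fsl (c d : Fin m → σ → ℂ) (b : ℕ) (ν : σ → ℕ) : ℂ :=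
  bsum (termC I c d b) (termA I c d b) (termD I b) ν

/-- The width of the slice sum is at most `2 m (b + 1)^3`. [folklore] -/
theorem bwidth_termD_le (b : ℕ) : bwidth (termD I b : SIdx m b → σ → ℕ) ≤ 2 * m * (b + 1) ^ 3 := by
  unfold bwidth
  have hterm : ∀ τ : SIdx m b, ∏ j, (termD I b τ j + 1) ≤ (b + 1) ^ 2 := by
    intro τ
    rw [prod_four_split I]
    have hr : ∏ j ∈ rest I, (termD I b τ j + 1) = 1 := by
      refine Finset.prod_eq_one fun j hj => ?_
      rw [mem_rest] at hj
      simp [termD, hj.1, hj.2.1]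
    rw [hr, one_mul]
    have ha : termD I b τ I.a = (τ.2 : ℕ) := by simp [termD]
    have hb : termD I b τ I.b = b - τ.2 := by simp [termD, I.hab.symm]
    have hc : termD I b τ I.c = 0 := by simp [termD, I.hac.symm, I.hbc.symm]
    have hd : termD I b τ I.d = 0 := by simp [termD, I.had.symm, I.hbd.symm]
    rw [ha, hb, hc, hd]
    have h2 := τ.2.isLt
    calc ((τ.2 : ℕ) + 1) * ((b - τ.2 + 1) * ((0 + 1) * (0 + 1))) = ((τ.2 : ℕ) + 1) * (b - τ.2 + 1) := by ring
      _ ≤ (b + 1) * (b + 1) := Nat.mul_le_mul (by omega) (by omega)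
      _ = (b + 1) ^ 2 := by ring
  calc ∑ τ : SIdx m b, ∏ j, (termD I b τ j + 1) ≤ ∑ _τ : SIdx m b, (b + 1) ^ 2 :=
        Finset.sum_le_sum fun τ _ => hterm τ
    _ = (2 * m * (b + 1)) * (b + 1) ^ 2 := by
        rw [Finset.sum_const, Finset.card_univ, smul_eq_mul]
        simp [Fintype.card_prod, Fintype.card_sum, Fintype.card_fin]; ring
    _ = 2 * m * (b + 1) ^ 3 := by ring

/-- **Per-term evaluation** of the slice sum at a reduced exponent `x̂` (slice `b = x_c`): the term `(t, k)` equals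
`± C(x_a, k) C(x_b, x_c - k) · mom (tab t) (Lof x k)`. [folklore] -/
theorem term_eval (c d : Fin m → σ → ℂ) (x : σ →₀ ℕ) (τ : SIdx m (x I.c)) :
    termC I c d (x I.c) τ * ∏ j, binChar (termA I c d (x I.c) τ j) (termD I (x I.c) τ j) (xhat I x j) =
      sgn m τ.1 * (((x I.a).choose τ.2 * (x I.b).choose (x I.c - τ.2) : ℕ) : ℂ) * mom (tab c d τ.1) (Lof I x τ.2) := by
  have hk : (τ.2 : ℕ) ≤ x I.c := Nat.lt_succ_iff.mp τ.2.isLt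
  unfold mom
  rw [prod_four_split I, prod_four_split I]
  -- the four special factors of the binomial product
  have hAa : termA I c d (x I.c) τ I.a = tab c d τ.1 I.c := by simp [termA]
  have hAb : termA I c d (x I.c) τ I.b = tab c d τ.1 I.b := by simp [termA, I.hab.symm, I.hbc, I.hbd]
  have hAc : termA I c d (x I.c) τ I.c = 0 := by simp [termA, I.hac.symm]
  have hAd : termA I c d (x I.c) τ I.d = 0 := by simp [termA, I.had.symm]
  have hDa : termD I (x I.c) τ I.a = (τ.2 : ℕ) := by simp [termD]
  have hDb : termD I (x I.c) τ I.b = x I.c - τ.2 := by simp [termD, I.hab.symm]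
  have hDc : termD I (x I.c) τ I.c = 0 := by simp [termD, I.hac.symm, I.hbc.symm]
  have hDd : termD I (x I.c) τ I.d = 0 := by simp [termD, I.had.symm, I.hbd.symm]
  rw [hAa, hAb, hAc, hAd, hDa, hDb, hDc, hDd, xhat_a, xhat_b, xhat_c, xhat_d, Lof_a, Lof_b, Lof_c, Lof_d,
    binChar_base_zero, if_pos rfl]
  -- the remaining factors agree
  have hr : ∏ j ∈ rest I, binChar (termA I c d (x I.c) τ j) (termD I (x I.c) τ j) (xhat I x j) =
      ∏ j ∈ rest I, tab c d τ.1 j ^ (Lof I x τ.2) j := by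
    refine Finset.prod_congr rfl fun j hj => ?_
    rw [mem_rest] at hj
    rw [Lof_other I x _ j hj.1 hj.2.1 hj.2.2.1 hj.2.2.2, xhat_other I x j hj.2.2.1 hj.2.2.2]
    have hA : termA I c d (x I.c) τ j = tab c d τ.1 j := by simp [termA, hj.1, hj.2.2.1, hj.2.2.2]
    have hD : termD I (x I.c) τ j = 0 := by simp [termD, hj.1, hj.2.1]
    rw [hA, hD, binChar_zero_deg]
  rw [hr, show x I.b + (τ.2 : ℕ) - x I.c = x I.b - (x I.c - τ.2) by omega]
  unfold binChar termC
  push_cast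
  ring

/-- **The slice sum at a reduced exponent** is the binomially weighted fibre sum of moment differences. [folklore] -/
theorem Fsl_xhat_eq (c d : Fin m → σ → ℂ) (x : σ →₀ ℕ) :
    Fsl I c d (x I.c) (xhat I x) = ∑ k ∈ Finset.range (x I.c + 1),
      (((x I.a).choose k * (x I.b).choose (x I.c - k) : ℕ) : ℂ) *
        (∑ j, mom (c j) (Lof I x k) - ∑ j, mom (d j) (Lof I x k)) := by
  unfold Fsl bsum
  rw [Fintype.sum_prod_type_right]
  rw [← Fin.sum_univ_eq_sum_range (fun k => (((x I.a).choose k * (x I.b).choose (x I.c - k) : ℕ) : ℂ) *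
        (∑ j, mom (c j) (Lof I x k) - ∑ j, mom (d j) (Lof I x k))) (x I.c + 1)]
  refine Finset.sum_congr rfl fun k _ => ?_
  rw [Fintype.sum_sum_type]
  simp only [term_eval]
  simp only [sgn, tab, Sum.elim_inl, Sum.elim_inr, one_mul, neg_one_mul, neg_mul, Finset.sum_neg_distrib,
    ← Finset.mul_sum]
  ring

theorem KR_subset_range (x : σ →₀ ℕ) : KR I x ⊆ Finset.range (x I.c + 1) := by
  intro k hk
  rw [mem_KR] at hk
  exact Finset.mem_range.mpr (by omega)

/-- **THE COEFFICIENT THEOREM.** For a balanced exponent `x` whose reduced degree `n = deg x̂` lies in `[1, R]`, the coefficient of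
`Y^x` in the Segre lift of the truncated logarithm is `(-1)^{n+1}/n · multinomial(x̂) · F(x_c; x̂)`. [folklore] -/
theorem coeff_segre_logTrunc (c d : Fin m → σ → ℂ) (R : ℕ) (x : σ →₀ ℕ) (hx : Balanced I x)
    (h1 : 1 ≤ deg (xhat I x)) (hR : deg (xhat I x) ≤ R) :
    coeff x (phiT (segM I) (logTrunc c d R)) =
      ((-1 : ℂ) ^ (deg (xhat I x) + 1) / (deg (xhat I x) : ℂ)) * ((xhat I x).multinomial : ℂ) *
        Fsl I c d (x I.c) (xhat I x) := by
  classical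
  rw [coeff_phiT]
  -- Step 1: reindex the fibre sum by `k = #α ∈ KR x`
  have step1 : ∑ L ∈ (logTrunc c d R).support with piT (segM I) L = x, coeff L (logTrunc c d R) =
      ∑ k ∈ KR I x, coeff (Lof I x k) (logTrunc c d R) := by
    rw [← Finset.sum_filter_add_sum_filter_not (KR I x) (fun k => Lof I x k ∈ (logTrunc c d R).support)]
    rw [Finset.sum_eq_zero (s := (KR I x).filter fun k => ¬ Lof I x k ∈ (logTrunc c d R).support)
      (fun k hk => notMem_support_iff.mp (Finset.mem_filter.mp hk).2), add_zero]
    apply Finset.sum_nbij' (fun L => L I.a) (fun k => Lof I x k)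
    · intro L hL
      rw [Finset.mem_filter] at hL
      obtain ⟨hk, hLeq⟩ := eq_Lof_of_piT I L x hL.2
      rw [Finset.mem_filter, ← hLeq]
      exact ⟨hk, hL.1⟩
    · intro k hk
      rw [Finset.mem_filter] at hk
      rw [Finset.mem_filter]
      exact ⟨hk.2, piT_Lof I x hx k hk.1⟩
    · intro L hL
      rw [Finset.mem_filter] at hL
      exact (eq_Lof_of_piT I L x hL.2).2.symm
    · intro k _
      exact Lof_a I x k
    · intro L hL
      rw [Finset.mem_filter] at hL
      obtain ⟨-, hLeq⟩ := eq_Lof_of_piT I L x hL.2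
      rw [← hLeq]
  rw [step1]
  -- Step 2: evaluate each fibre coefficient and regroup the multinomial
  have step2 : ∀ k ∈ KR I x, coeff (Lof I x k) (logTrunc c d R) =
      ((-1 : ℂ) ^ (deg (xhat I x) + 1) / (deg (xhat I x) : ℂ)) * (((xhat I x).multinomial : ℂ) *
        ((((x I.a).choose k * (x I.b).choose (x I.c - k) : ℕ) : ℂ) *
          (∑ j, mom (c j) (Lof I x k) - ∑ j, mom (d j) (Lof I x k)))) := by
    intro k hk
    have hdeg := deg_Lof I x k hk
    rw [coeff_logTrunc c d R _ (by rw [hdeg]; exact h1) (by rw [hdeg]; exact hR), hdeg, multinomial_Lof I x k hk]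
    push_cast; ring
  rw [Finset.sum_congr rfl step2, ← Finset.mul_sum, ← Finset.mul_sum, Fsl_xhat_eq]
  -- Step 3: the binomial weights vanish off `KR x`
  rw [← Finset.sum_subset (KR_subset_range I x) (fun k hk hnk => by
    rw [mem_KR] at hnk
    have hk' : k ≤ x I.c := Nat.lt_succ_iff.mp (Finset.mem_range.mp hk)
    have : (x I.a).choose k * (x I.b).choose (x I.c - k) = 0 := by
      rcases Nat.lt_or_ge (x I.a) k with h | h
      · rw [Nat.choose_eq_zero_of_lt h, zero_mul]
      · have h2 : x I.b < x I.c - k := by omega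
        rw [Nat.choose_eq_zero_of_lt h2, mul_zero]
    rw [this, Nat.cast_zero, zero_mul])]
  ring

/-- The support criterion: a balanced `x` with reduced degree in `[1, R]` lies in the support of the lifted truncated logarithm iff
its slice sum does not vanish at `x̂`. [folklore] -/
theorem mem_support_segre_logTrunc_iff (c d : Fin m → σ → ℂ) (R : ℕ) (x : σ →₀ ℕ) (hx : Balanced I x)
    (h1 : 1 ≤ deg (xhat I x)) (hR : deg (xhat I x) ≤ R) :
    x ∈ (phiT (segM I) (logTrunc c d R)).support ↔ Fsl I c d (x I.c) (xhat I x) ≠ 0 := by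
  rw [mem_support_iff, coeff_segre_logTrunc I c d R x hx h1 hR]
  have hk : (deg (xhat I x) : ℂ) ≠ 0 := Nat.cast_ne_zero.mpr (by omega)
  have hc : ((-1 : ℂ) ^ (deg (xhat I x) + 1) / (deg (xhat I x) : ℂ)) ≠ 0 :=
    div_ne_zero (pow_ne_zero _ (neg_ne_zero.mpr one_ne_zero)) hk
  have hm := multinomial_cast_ne_zero (xhat I x)
  constructor
  · intro h hF; exact h (by rw [hF, mul_zero])
  · intro h; exact mul_ne_zero (mul_ne_zero hc hm) h

/-- Non-vanishing of a slice sum forces `ν_c = ν_d = 0` and `b ≤ ν_a + ν_b`. [folklore] -/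
theorem shape_of_Fsl_ne_zero (c d : Fin m → σ → ℂ) (b : ℕ) (ν : σ → ℕ) (h : Fsl I c d b ν ≠ 0) :
    ν I.c = 0 ∧ ν I.d = 0 ∧ b ≤ ν I.a + ν I.b := by
  by_contra hcon
  apply h
  unfold Fsl bsum
  refine Finset.sum_eq_zero fun τ _ => ?_
  rw [mul_eq_zero]; right
  have hAc : termA I c d b τ I.c = 0 := by simp [termA, I.hac.symm]
  have hAd : termA I c d b τ I.d = 0 := by simp [termA, I.had.symm]
  have hDa : termD I b τ I.a = (τ.2 : ℕ) := by simp [termD]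
  have hDb : termD I b τ I.b = b - τ.2 := by simp [termD, I.hab.symm]
  have hDc : termD I b τ I.c = 0 := by simp [termD, I.hac.symm, I.hbc.symm]
  have hDd : termD I b τ I.d = 0 := by simp [termD, I.had.symm, I.hbd.symm]
  by_cases hc : ν I.c = 0
  · by_cases hd : ν I.d = 0
    · have hlt : ν I.a + ν I.b < b := by omega
      rcases Nat.lt_or_ge (ν I.a) τ.2 with h1 | h1
      · exact Finset.prod_eq_zero (Finset.mem_univ I.a) (by rw [hDa]; exact binChar_eq_zero_of_lt _ _ _ h1)
      · exact Finset.prod_eq_zero (Finset.mem_univ I.b) (by rw [hDb]; exact binChar_eq_zero_of_lt _ _ _ (by omega))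
    · exact Finset.prod_eq_zero (Finset.mem_univ I.d) (by rw [hAd, hDd, binChar_base_zero, if_neg hd])
  · exact Finset.prod_eq_zero (Finset.mem_univ I.c) (by rw [hAc, hDc, binChar_base_zero, if_neg hc])

/-- The slice sum vanishes at the origin of the slice `b = 0` (equal numbers of `±` atoms). [folklore] -/
theorem Fsl_zero_zero (c d : Fin m → σ → ℂ) (ν : σ → ℕ) (hν : ∀ j, ν j = 0) : Fsl I c d 0 ν = 0 := by
  unfold Fsl bsum
  have : ∀ τ : SIdx m 0, termC I c d 0 τ * ∏ j, binChar (termA I c d 0 τ j) (termD I 0 τ j) (ν j) = sgn m τ.1 := by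
    intro τ
    have hk : (τ.2 : ℕ) = 0 := by have := τ.2.isLt; omega
    have hprod : ∏ j, binChar (termA I c d 0 τ j) (termD I 0 τ j) (ν j) = 1 := by
      refine Finset.prod_eq_one fun j _ => ?_
      have hD : termD I 0 τ j = 0 := by
        unfold termD; split_ifs <;> simp [hk]
      rw [hD, hν j]; simp [binChar]
    rw [hprod, mul_one]; unfold termC; rw [hk]; simp
  simp only [this]
  rw [Fintype.sum_prod_type, Fintype.sum_sum_type]
  simp [sgn]

/-- The balanced exponent with prescribed slice `b` and reduced part `ν` (`ν_c = ν_d = 0`, `b ≤ ν_a + ν_b`). [folklore] -/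
def xOf (b : ℕ) (ν : σ → ℕ) : σ →₀ ℕ :=
  ofFun fun j => if j = I.c then b else if j = I.d then ν I.a + ν I.b - b else ν j

theorem xOf_c (b : ℕ) (ν : σ → ℕ) : xOf I b ν I.c = b := by
  simp [xOf]

theorem xOf_balanced (b : ℕ) (ν : σ → ℕ) (hb : b ≤ ν I.a + ν I.b) : Balanced I (xOf I b ν) := by
  unfold Balanced xOf
  simp [I.hac, I.had, I.hbc, I.hbd, I.hcd.symm]
  omega

theorem xhat_xOf (b : ℕ) (ν : σ → ℕ) (hc : ν I.c = 0) (hd : ν I.d = 0) : ⇑(xhat I (xOf I b ν)) = ν := by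
  funext j
  by_cases hjc : j = I.c
  · subst hjc; rw [xhat_c, hc]
  by_cases hjd : j = I.d
  · subst hjd; rw [xhat_d, hd]
  rw [xhat_other I _ j hjc hjd]
  simp [xOf, hjc, hjd]

theorem xOf_xhat (x : σ →₀ ℕ) (hx : Balanced I x) : xOf I (x I.c) (xhat I x) = x := by
  unfold Balanced at hx
  ext j
  by_cases hjc : j = I.c
  · subst hjc; rw [xOf_c]
  by_cases hjd : j = I.d
  · subst hjd; simp [xOf, I.hcd.symm, xhat_a, xhat_b]; omega
  simp [xOf, hjc, hjd, xhat_other I x j hjc hjd]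

end Slice

/-! ## Part T5: Lemma A upstairs — strict minima of a toric lift of the chain are strict minima of the toric lift of the truncated
logarithm (generic Wronskian chain `strictMin_sub_iff_of_congr` + `coeff_wronskian_congr` with factors `1 + φ(lin c_j)`) -/

section LemmaA
variable {τ : Type*} [Fintype τ] [DecidableEq τ] (M : σ → (τ →₀ ℕ)) {m : ℕ}

omit [DecidableEq σ] in
theorem coeff_zero_phiT_lin (hM : ∀ i, M i ≠ 0) (a : σ → ℂ) : coeff 0 (phiT M (lin a)) = 0 := by
  classical
  unfold lin
  rw [map_sum, coeff_sum]
  refine Finset.sum_eq_zero fun i _ => ?_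
  rw [map_smul, phiT_X, coeff_smul, coeff_monomial, if_neg (hM i), smul_zero]

omit [DecidableEq σ] in
theorem coeff_zero_one_add_phiT_lin (hM : ∀ i, M i ≠ 0) (a : σ → ℂ) : coeff 0 (1 + phiT M (lin a)) = 1 := by
  rw [coeff_add, coeff_zero_phiT_lin M hM, add_zero, coeff_zero_one]

omit [DecidableEq σ] [Fintype τ] [DecidableEq τ] in
theorem phiT_liftG (c d : Fin m → σ → ℂ) :
    phiT M (liftG c d) = ∏ j, (1 + phiT M (lin (c j))) - ∏ j, (1 + phiT M (lin (d j))) := by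
  unfold liftG
  simp only [map_sub, map_prod, map_add, map_one]

omit [DecidableEq σ] [Fintype τ] [DecidableEq τ] in
theorem phiT_logTrunc (c d : Fin m → σ → ℂ) (R : ℕ) :
    phiT M (logTrunc c d R) = ∑ r ∈ Finset.Icc 1 R, ((-1 : ℂ) ^ (r + 1) / (r : ℂ)) •
      (∑ j, ((1 + phiT M (lin (c j))) - 1) ^ r - ∑ j, ((1 + phiT M (lin (d j))) - 1) ^ r) := by
  unfold logTrunc
  simp only [map_sum, map_smul, map_sub, map_pow, map_add, map_one]

/-- **Lemma A for a toric lift.** If `x₀` is a strict `θ`-minimum (`θ ≥ 1`) of the support of `φ_M(G)`, then it is a strict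
`θ`-minimum of the support of `φ_M(Λ_R)`, `R = ⌊θ(x₀)⌋ + 1`. [folklore] -/
theorem toric_minLog (hM : ∀ i, M i ≠ 0) (θ : τ → ℝ) (hθ : ∀ i, 1 ≤ θ i) (c d : Fin m → σ → ℂ) (x₀ : τ →₀ ℕ)
    (h : x₀ ∈ (phiT M (liftG c d)).support ∧ ∀ x ∈ (phiT M (liftG c d)).support, x ≠ x₀ → lwt θ x₀ < lwt θ x) :
    x₀ ∈ (phiT M (logTrunc c d (⌊lwt θ x₀⌋₊ + 1))).support ∧
      ∀ x ∈ (phiT M (logTrunc c d (⌊lwt θ x₀⌋₊ + 1))).support, x ≠ x₀ → lwt θ x₀ < lwt θ x := by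
  have hadd := lwt_add θ
  have hpos := one_le_lwt_of_ne_zero θ hθ
  set R : ℕ := ⌊lwt θ x₀⌋₊ + 1 with hRdef
  have hR : lwt θ x₀ < (R : ℝ) := by
    rw [hRdef]; push_cast; exact Nat.lt_floor_add_one _
  have hu : ∀ j, coeff 0 (1 + phiT M (lin (c j))) = 1 := fun j => coeff_zero_one_add_phiT_lin M hM (c j)
  have hv : ∀ j, coeff 0 (1 + phiT M (lin (d j))) = 1 := fun j => coeff_zero_one_add_phiT_lin M hM (d j)
  have key := strictMin_sub_iff_of_congr (lwt θ) hadd hpos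
    (MvPolynomial.mkDerivation ℂ fun i : τ => ((θ i : ℝ) : ℂ) • (X i : MvPolynomial τ ℂ))
    (coeff_eulerDerivation θ) (∏ j, (1 + phiT M (lin (c j)))) (∏ j, (1 + phiT M (lin (d j)))) _
    (coeff_zero_prod_eq_one _ hu) (coeff_zero_prod_eq_one _ hv) (coeff_zero_logTrunc _ _ hu hv R) R
    (coeff_wronskian_congr _ hadd hpos _ _ _ hu hv R) x₀ hR
  rw [← phiT_liftG, ← phiT_logTrunc] at key
  exact key.mp h

end LemmaA

/-! ## Part T6: the planar instance — relation data, the refined planar push-forward `E'`, injectivity from rank-one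
coincidences, and the upstairs weights -/

section SegrePlanar
open Summit.ValiantsHypothesis.ValiantsHypothesis.Theorems.NewtonUnitEquations.TwoProducts.FormalLogLinearisation
open Summit.ValiantsHypothesis.ValiantsHypothesis.Theorems.NewtonUnitEquations.TwoProducts.PlanarCell

variable {m : ℕ}

/-- **Rank-one coincidences** of a letter family (verbatim the R6 sketch's `RankOneCoincidences`): every additive coincidence of
two tuples is, at the level of letter multisets, a multiple of the one relation `ρ⁺ ~ ρ⁻`. [folklore] -/
def RankOneCoincidences (A : Fin m → Finset Expo) (ρp ρm : Expo →₀ ℕ) : Prop :=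
  ∀ a ∈ tuples A, ∀ b ∈ tuples A, ∑ j, a j = ∑ j, b j →
    ∃ k : ℕ, msetT a + k • ρp = msetT b + k • ρm ∨ msetT b + k • ρp = msetT a + k • ρm

omit [Fintype σ] [DecidableEq σ] in
/-- Permutation type is the case `k = 0`. [folklore] -/
theorem rankOneCoincidences_of_permType (A : Fin m → Finset Expo) (h : PermType A) (ρp ρm : Expo →₀ ℕ) :
    RankOneCoincidences A ρp ρm := fun a ha b hb hab => ⟨0, Or.inl (by simpa using h a ha b hb hab)⟩

omit [Fintype σ] [DecidableEq σ] in
/-- Letters of a tuple lie in the family. [folklore] -/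
theorem msetT_apply_eq_zero (A : Fin m → Finset Expo) (a : Fin m → Expo) (ha : a ∈ tuples A) (e : Expo)
    (he : ∀ j, e ∉ A j) : msetT a e = 0 := by
  classical
  unfold msetT
  rw [Finsupp.finset_sum_apply]
  refine Finset.sum_eq_zero fun j _ => ?_
  by_cases h0 : a j = 0
  · rw [if_pos h0]; rfl
  · rw [if_neg h0, Finsupp.single_apply, if_neg]
    intro hje
    have hmem := Fintype.mem_piFinset.1 ha j
    rw [Finset.mem_insert] at hmem
    rcases hmem with h | h
    · exact h0 h
    · exact he j (hje ▸ h)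

omit [Fintype σ] [DecidableEq σ] in
/-- **Degenerate relations.** If one of the four relation letters is absent from the family, rank-one coincidences for the
four-term relation are already of permutation type. [folklore] -/
theorem permType_of_absent_letter (A : Fin m → Finset Expo) (α β γ δ : Expo) (hab : α ≠ β) (hac : α ≠ γ) (had : α ≠ δ)
    (hbc : β ≠ γ) (hbd : β ≠ δ) (hcd : γ ≠ δ)
    (hR : RankOneCoincidences A (Finsupp.single γ 1 + Finsupp.single δ 1) (Finsupp.single α 1 + Finsupp.single β 1))
    (e : Expo) (he : e = α ∨ e = β ∨ e = γ ∨ e = δ) (hnot : ∀ j, e ∉ A j) : PermType A := by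
  intro a ha b hb hab'
  obtain ⟨k, hk⟩ := hR a ha b hb hab'
  have ha0 := msetT_apply_eq_zero A a ha e hnot
  have hb0 := msetT_apply_eq_zero A b hb e hnot
  have hk0 : k = 0 := by
    rcases hk with hk | hk <;>
    · have h1 := DFunLike.congr_fun hk e
      simp only [Finsupp.add_apply, Finsupp.smul_apply, smul_eq_mul, Finsupp.single_apply, ha0, hb0] at h1
      rcases he with rfl | rfl | rfl | rfl <;>
        simp [hab, hac, had, hbc, hbd, hcd, hab.symm, hac.symm, had.symm, hbc.symm, hbd.symm, hcd.symm] at h1 <;> omega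
  subst hk0
  simp only [zero_smul, add_zero] at hk
  rcases hk with hk | hk
  · exact hk
  · exact hk.symm

variable (u v : Fin m → MvPolynomial (Fin 2) ℂ)

/-- The index of a tail letter. [folklore] -/
def idxOf (e : Expo) (he : e ∈ tailSupport u v) : Fin (sE u v) := (tailSupport u v).equivFin ⟨e, he⟩

omit [Fintype σ] [DecidableEq σ] in
theorem enum_idxOf (e : Expo) (he : e ∈ tailSupport u v) : enum u v (idxOf u v e he) = e := by
  unfold enum idxOf
  rw [Equiv.symm_apply_apply]

/-- **Planar four-term relation data**: distinct tail letters `α, β, γ, δ` with `α + β = γ + δ`. [folklore] -/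
structure RelData where
  /-- the letter `α` -/
  α : Expo
  /-- the letter `β` -/
  β : Expo
  /-- the letter `γ` -/
  γ : Expo
  /-- the letter `δ` -/
  δ : Expo
  hα : α ∈ tailSupport u v
  hβ : β ∈ tailSupport u v
  hγ : γ ∈ tailSupport u v
  hδ : δ ∈ tailSupport u v
  hab : α ≠ β
  hac : α ≠ γ
  had : α ≠ δ
  hbc : β ≠ γ
  hbd : β ≠ δ
  hcd : γ ≠ δ
  hrel : α + β = γ + δ

variable {u v}
variable (D : RelData u v)

/-- The four indices of the relation letters. [folklore] -/
def RelData.idx : FourIdx (Fin (sE u v)) where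
  a := idxOf u v D.α D.hα
  b := idxOf u v D.β D.hβ
  c := idxOf u v D.γ D.hγ
  d := idxOf u v D.δ D.hδ
  hab h := D.hab (by have := congrArg (enum u v) h; rwa [enum_idxOf, enum_idxOf] at this)
  hac h := D.hac (by have := congrArg (enum u v) h; rwa [enum_idxOf, enum_idxOf] at this)
  had h := D.had (by have := congrArg (enum u v) h; rwa [enum_idxOf, enum_idxOf] at this)
  hbc h := D.hbc (by have := congrArg (enum u v) h; rwa [enum_idxOf, enum_idxOf] at this)
  hbd h := D.hbd (by have := congrArg (enum u v) h; rwa [enum_idxOf, enum_idxOf] at this)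
  hcd h := D.hcd (by have := congrArg (enum u v) h; rwa [enum_idxOf, enum_idxOf] at this)

omit [Fintype σ] [DecidableEq σ] in
theorem RelData.enum_a : enum u v D.idx.a = D.α := enum_idxOf u v _ _
omit [Fintype σ] [DecidableEq σ] in
theorem RelData.enum_b : enum u v D.idx.b = D.β := enum_idxOf u v _ _
omit [Fintype σ] [DecidableEq σ] in
theorem RelData.enum_c : enum u v D.idx.c = D.γ := enum_idxOf u v _ _
omit [Fintype σ] [DecidableEq σ] in
theorem RelData.enum_d : enum u v D.idx.d = D.δ := enum_idxOf u v _ _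

/-- **The refined planar push-forward** (`ℕ²`-Riesz refinement of the relation):
`Z₁ ↦ α ⊓ γ`, `Z₂ ↦ β ⊓ δ`, `W₁ ↦ α - α ⊓ γ`, `W₂ ↦ γ - α ⊓ γ`, other letters unchanged. [folklore] -/
def RelData.E' (i : Fin (sE u v)) : Expo :=
  if i = D.idx.a then D.α ⊓ D.γ else if i = D.idx.b then D.β ⊓ D.δ
  else if i = D.idx.c then D.α - D.α ⊓ D.γ else if i = D.idx.d then D.γ - D.α ⊓ D.γ else enum u v i

omit [Fintype σ] [DecidableEq σ] in
theorem RelData.E'_a : D.E' D.idx.a = D.α ⊓ D.γ := by unfold RelData.E'; rw [if_pos rfl]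
omit [Fintype σ] [DecidableEq σ] in
theorem RelData.E'_b : D.E' D.idx.b = D.β ⊓ D.δ := by unfold RelData.E'; rw [if_neg D.idx.hab.symm, if_pos rfl]
omit [Fintype σ] [DecidableEq σ] in
theorem RelData.E'_c : D.E' D.idx.c = D.α - D.α ⊓ D.γ := by
  unfold RelData.E'; rw [if_neg D.idx.hac.symm, if_neg D.idx.hbc.symm, if_pos rfl]
omit [Fintype σ] [DecidableEq σ] in
theorem RelData.E'_d : D.E' D.idx.d = D.γ - D.α ⊓ D.γ := by
  unfold RelData.E'; rw [if_neg D.idx.had.symm, if_neg D.idx.hbd.symm, if_neg D.idx.hcd.symm, if_pos rfl]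
omit [Fintype σ] [DecidableEq σ] in
theorem RelData.E'_other (i : Fin (sE u v)) (ha : i ≠ D.idx.a) (hb : i ≠ D.idx.b) (hc : i ≠ D.idx.c) (hd : i ≠ D.idx.d) :
    D.E' i = enum u v i := by
  unfold RelData.E'; rw [if_neg ha, if_neg hb, if_neg hc, if_neg hd]

omit [Fintype σ] [DecidableEq σ] in
/-- The four Riesz identities: the refined push-forward composed with the Segre substitution is the letter map. [folklore] -/
theorem RelData.piE_E'_segM (i : Fin (sE u v)) : piE D.E' (segM D.idx i) = enum u v i := by
  have hrel : ∀ k, D.α k + D.β k = D.γ k + D.δ k := fun k => by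
    have := DFunLike.congr_fun D.hrel k
    simpa only [Finsupp.add_apply] using this
  have hsum : ∀ p q : Fin (sE u v), piE D.E' (Finsupp.single p 1 + Finsupp.single q 1) = D.E' p + D.E' q := by
    intro p q
    rw [piE_eq_piT, piT_add, piT_single, piT_single, one_smul, one_smul]
  by_cases hia : i = D.idx.a
  · subst hia
    rw [segM_a, hsum, D.E'_a, D.E'_c, D.enum_a]
    ext k
    simp only [Finsupp.add_apply, Finsupp.inf_apply, Finsupp.tsub_apply]
    omega
  by_cases hib : i = D.idx.b
  · subst hib
    rw [segM_b, hsum, D.E'_b, D.E'_d, D.enum_b]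
    ext k
    simp only [Finsupp.add_apply, Finsupp.inf_apply, Finsupp.tsub_apply]
    have := hrel k
    omega
  by_cases hic : i = D.idx.c
  · subst hic
    rw [segM_c, hsum, D.E'_a, D.E'_d, D.enum_c]
    ext k
    simp only [Finsupp.add_apply, Finsupp.inf_apply, Finsupp.tsub_apply]
    omega
  by_cases hid : i = D.idx.d
  · subst hid
    rw [segM_d, hsum, D.E'_b, D.E'_c, D.enum_d]
    ext k
    simp only [Finsupp.add_apply, Finsupp.inf_apply, Finsupp.tsub_apply]
    have := hrel k
    omega
  rw [segM_other D.idx i hia hib hic hid, piE_eq_piT, piT_single, one_smul, D.E'_other i hia hib hic hid]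

omit [Fintype σ] [DecidableEq σ] in
/-- On exponents: refined push-forward ∘ Segre = letter push-forward. [folklore] -/
theorem RelData.piE_E'_piT (L : Fin (sE u v) →₀ ℕ) : piE D.E' (piT (segM D.idx) L) = piE (enum u v) L := by
  have hM : (fun i => piT D.E' (segM D.idx i)) = enum u v := by
    funext i
    rw [← piE_eq_piT]
    exact D.piE_E'_segM i
  rw [piE_eq_piT, piE_eq_piT, piT_piT, hM]

omit [Fintype σ] [DecidableEq σ] in
/-- On polynomials: refined push-forward ∘ Segre = letter push-forward. [folklore] -/
theorem RelData.phi_E'_phiT (H : MvPolynomial (Fin (sE u v)) ℂ) : phi D.E' (phiT (segM D.idx) H) = phi (enum u v) H := by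
  have hM : (fun i => piT D.E' (segM D.idx i)) = enum u v := by
    funext i
    rw [← piE_eq_piT]
    exact D.piE_E'_segM i
  rw [phi_eq_phiT, phi_eq_phiT, phiT_phiT, hM]

/-- The Segre lift of the chain difference. [folklore] -/
def RelData.GT : MvPolynomial (Fin (sE u v)) ℂ := phiT (segM D.idx) (liftG (cU u v) (cV u v))

omit [Fintype σ] [DecidableEq σ] in
/-- Its refined push-forward is the planar difference of products. [folklore] -/
theorem RelData.phi_GT : phi D.E' D.GT = tailDiff u v := by
  unfold RelData.GT
  rw [D.phi_E'_phiT, phi_liftG]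

omit [Fintype σ] [DecidableEq σ] in
/-- Support points of the Segre lift are balanced toric images of chain-support multisets. [folklore] -/
theorem RelData.exists_of_mem_support_GT (x : Fin (sE u v) →₀ ℕ) (hx : x ∈ D.GT.support) :
    ∃ L ∈ (liftG (cU u v) (cV u v)).support, piT (segM D.idx) L = x :=
  exists_of_mem_support_phiT (segM D.idx) _ x hx

omit [Fintype σ] [DecidableEq σ] in
/-- **Injectivity from rank-one coincidences.** [folklore] -/
theorem RelData.injOn_of_rankOne (hu : ∀ j, coeff 0 (u j) = 0) (hv : ∀ j, coeff 0 (v j) = 0)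
    (hR : RankOneCoincidences (fun j => (u j).support ∪ (v j).support)
      (Finsupp.single D.γ 1 + Finsupp.single D.δ 1) (Finsupp.single D.α 1 + Finsupp.single D.β 1)) :
    Set.InjOn (piE D.E') ↑D.GT.support := by
  classical
  set A : Fin m → Finset Expo := fun j => (u j).support ∪ (v j).support with hA
  have hcU : ∀ j i, cU u v j i ≠ 0 → enum u v i ∈ A j := fun j i h =>
    Finset.mem_union_left _ (mem_support_iff.mpr h)
  have hcV : ∀ j i, cV u v j i ≠ 0 → enum u v i ∈ A j := fun j i h =>
    Finset.mem_union_right _ (mem_support_iff.mpr h)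
  have key : ∀ κ ∈ (liftG (cU u v) (cV u v)).support,
      ∃ a ∈ tuples A, ∑ j, a j = piE (enum u v) κ ∧ msetT a = Finsupp.mapDomain (enum u v) κ := by
    intro κ hκ
    unfold liftG at hκ
    rcases Finset.mem_union.1 (support_sub _ _ _ hκ) with h | h
    · exact tuple_of_mem_support_prod u v hu hv A (cU u v) hcU κ h
    · exact tuple_of_mem_support_prod u v hu hv A (cV u v) hcV κ h
  -- the relation upstairs
  set ρp : Fin (sE u v) →₀ ℕ := Finsupp.single D.idx.c 1 + Finsupp.single D.idx.d 1 with hρp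
  set ρm : Fin (sE u v) →₀ ℕ := Finsupp.single D.idx.a 1 + Finsupp.single D.idx.b 1 with hρm
  have hmp : Finsupp.mapDomain (enum u v) ρp = Finsupp.single D.γ 1 + Finsupp.single D.δ 1 := by
    rw [hρp, Finsupp.mapDomain_add, Finsupp.mapDomain_single, Finsupp.mapDomain_single, D.enum_c, D.enum_d]
  have hmm : Finsupp.mapDomain (enum u v) ρm = Finsupp.single D.α 1 + Finsupp.single D.β 1 := by
    rw [hρm, Finsupp.mapDomain_add, Finsupp.mapDomain_single, Finsupp.mapDomain_single, D.enum_a, D.enum_b]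
  have hπρ : piT (segM D.idx) ρp = piT (segM D.idx) ρm := by
    rw [hρp, hρm, piT_add, piT_add, piT_single, piT_single, piT_single, piT_single, one_smul, one_smul, one_smul,
      one_smul, segM_rel]
  have hmapk : ∀ (k : ℕ) (L ρ : Fin (sE u v) →₀ ℕ),
      Finsupp.mapDomain (enum u v) (L + k • ρ) = Finsupp.mapDomain (enum u v) L + k • Finsupp.mapDomain (enum u v) ρ := by
    intro k L ρ
    rw [Finsupp.mapDomain_add]
    congr 1
    exact map_nsmul (Finsupp.mapDomain.addMonoidHom (enum u v)) k ρ
  -- cancellation upstairs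
  have cancel : ∀ (k : ℕ) (L L' : Fin (sE u v) →₀ ℕ), L + k • ρp = L' + k • ρm →
      piT (segM D.idx) L = piT (segM D.idx) L' := by
    intro k L L' h
    have := congrArg (piT (segM D.idx)) h
    rw [piT_add, piT_add, piT_nsmul, piT_nsmul, hπρ] at this
    exact add_right_cancel this
  intro x hx x' hx' hπ
  obtain ⟨L, hL, rfl⟩ := D.exists_of_mem_support_GT x hx
  obtain ⟨L', hL', rfl⟩ := D.exists_of_mem_support_GT x' hx'
  rw [D.piE_E'_piT, D.piE_E'_piT] at hπ
  obtain ⟨a, ha, haS, haM⟩ := key L hL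
  obtain ⟨b, hb, hbS, hbM⟩ := key L' hL'
  obtain ⟨k, hk⟩ := hR a ha b hb (by rw [haS, hbS]; exact hπ)
  rw [haM, hbM, ← hmp, ← hmm, ← hmapk, ← hmapk, ← hmapk, ← hmapk] at hk
  rcases hk with hk | hk
  · exact cancel k L L' (Finsupp.mapDomain_injective (enum_injective u v) hk)
  · exact (cancel k L' L (Finsupp.mapDomain_injective (enum_injective u v) hk)).symm

omit [Fintype σ] [DecidableEq σ] in
/-- Visible points lift to strict `ξ`-maxima of the Segre-lifted support (under injectivity). [folklore] -/
theorem RelData.lifted_of_visible (hinj : Set.InjOn (piE D.E') ↑D.GT.support) (ξ : Fin 2 → ℝ) (l : Expo)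
    (htop : IsStrictTop ξ ↑(tailDiff u v).support l) :
    ∃ x₀ : Fin (sE u v) →₀ ℕ, x₀ ∈ D.GT.support ∧ piE D.E' x₀ = l ∧
      ∀ x ∈ D.GT.support, x ≠ x₀ → wt ξ (piE D.E' x) < wt ξ l := by
  have hsupp : tailDiff u v = phi D.E' D.GT := D.phi_GT.symm
  obtain ⟨hl, hlt⟩ := htop
  have hl' : l ∈ (phi D.E' D.GT).support := by rw [← hsupp]; exact hl
  obtain ⟨x₀, hx₀, hπ⟩ := exists_of_mem_support_phi D.E' _ l hl'
  refine ⟨x₀, hx₀, hπ, fun x hx hne => ?_⟩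
  have hcoeff : coeff (piE D.E' x) (tailDiff u v) ≠ 0 := by
    rw [hsupp, coeff_phi_of_injOn D.E' _ hinj x hx]
    exact mem_support_iff.mp hx
  have hneπ : piE D.E' x ≠ l := fun h => hne (hinj hx hx₀ (h.trans hπ.symm))
  exact hlt _ (mem_support_iff.mpr hcoeff) hneπ

/-! ### The upstairs weights -/

/-- Letter weights `r_i = -wt ξ (enum i) > 0`. [folklore] -/
def rW (ξ : Fin 2 → ℝ) (i : Fin (sE u v)) : ℝ := -wt ξ (enum u v i)

/-- The free parameter `t = z₁` of the Riesz weight refinement: midpoint of `(max(0, Γ - B), min(A, Γ))`. [folklore] -/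
def RelData.tPar (ξ : Fin 2 → ℝ) : ℝ :=
  (max 0 (rW (u := u) (v := v) ξ D.idx.c - rW ξ D.idx.b) + min (rW ξ D.idx.a) (rW ξ D.idx.c)) / 2

/-- **The upstairs weights** `θ`: `z₁ = t`, `z₂ = B - Γ + t`, `w₁ = A - t`, `w₂ = Γ - t`, `r_i` elsewhere. [folklore] -/
def RelData.theta (ξ : Fin 2 → ℝ) (i : Fin (sE u v)) : ℝ :=
  if i = D.idx.a then D.tPar ξ else if i = D.idx.b then rW ξ D.idx.b - rW ξ D.idx.c + D.tPar ξ
  else if i = D.idx.c then rW ξ D.idx.a - D.tPar ξ else if i = D.idx.d then rW ξ D.idx.c - D.tPar ξ else rW ξ i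

omit [Fintype σ] [DecidableEq σ] in
theorem RelData.theta_a (ξ : Fin 2 → ℝ) : D.theta ξ D.idx.a = D.tPar ξ := by
  unfold RelData.theta; rw [if_pos rfl]
omit [Fintype σ] [DecidableEq σ] in
theorem RelData.theta_b (ξ : Fin 2 → ℝ) : D.theta ξ D.idx.b = rW ξ D.idx.b - rW ξ D.idx.c + D.tPar ξ := by
  unfold RelData.theta; rw [if_neg D.idx.hab.symm, if_pos rfl]
omit [Fintype σ] [DecidableEq σ] in
theorem RelData.theta_c (ξ : Fin 2 → ℝ) : D.theta ξ D.idx.c = rW ξ D.idx.a - D.tPar ξ := by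
  unfold RelData.theta; rw [if_neg D.idx.hac.symm, if_neg D.idx.hbc.symm, if_pos rfl]
omit [Fintype σ] [DecidableEq σ] in
theorem RelData.theta_d (ξ : Fin 2 → ℝ) : D.theta ξ D.idx.d = rW ξ D.idx.c - D.tPar ξ := by
  unfold RelData.theta; rw [if_neg D.idx.had.symm, if_neg D.idx.hbd.symm, if_neg D.idx.hcd.symm, if_pos rfl]
omit [Fintype σ] [DecidableEq σ] in
theorem RelData.theta_other (ξ : Fin 2 → ℝ) (i : Fin (sE u v)) (ha : i ≠ D.idx.a) (hb : i ≠ D.idx.b) (hc : i ≠ D.idx.c)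
    (hd : i ≠ D.idx.d) : D.theta ξ i = rW ξ i := by
  unfold RelData.theta; rw [if_neg ha, if_neg hb, if_neg hc, if_neg hd]

omit [Fintype σ] [DecidableEq σ] in
/-- The relation on weights: `A + B = Γ + Δ`. [folklore] -/
theorem RelData.rW_rel (ξ : Fin 2 → ℝ) : rW ξ D.idx.a + rW ξ D.idx.b = rW ξ D.idx.c + rW ξ D.idx.d := by
  unfold rW
  rw [D.enum_a, D.enum_b, D.enum_c, D.enum_d, ← neg_add, ← neg_add, ← wt_add, ← wt_add, D.hrel]

omit [Fintype σ] [DecidableEq σ] in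
/-- The upstairs weights are strictly positive for a valid `ξ`. [folklore] -/
theorem RelData.theta_pos (ξ : Fin 2 → ℝ) (hval : ValidWeight u v ξ) (i : Fin (sE u v)) : 0 < D.theta ξ i := by
  have hr : ∀ j, 0 < rW (u := u) (v := v) ξ j := fun j => by
    unfold rW; linarith [wt_enum_neg u v ξ hval j]
  have hA := hr D.idx.a; have hB := hr D.idx.b; have hC := hr D.idx.c; have hD := hr D.idx.d
  have hrel := D.rW_rel ξ
  have hlo : max 0 (rW (u := u) (v := v) ξ D.idx.c - rW ξ D.idx.b) < min (rW (u := u) (v := v) ξ D.idx.a) (rW ξ D.idx.c) := by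
    rw [max_lt_iff, lt_min_iff, lt_min_iff]
    exact ⟨⟨hA, hC⟩, by linarith, by linarith⟩
  have ht1 : max 0 (rW (u := u) (v := v) ξ D.idx.c - rW ξ D.idx.b) < D.tPar ξ := by
    unfold RelData.tPar; linarith
  have ht2 : D.tPar ξ < min (rW (u := u) (v := v) ξ D.idx.a) (rW ξ D.idx.c) := by
    unfold RelData.tPar; linarith
  rw [max_lt_iff] at ht1
  rw [lt_min_iff] at ht2
  unfold RelData.theta
  split_ifs
  · exact ht1.1
  · linarith [ht1.2]
  · linarith [ht2.1]
  · linarith [ht2.2]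
  · exact hr i

omit [DecidableEq σ] in
/-- Linear weights of a single letter. [folklore] -/
theorem lwt_single (θ : σ → ℝ) (i : σ) : lwt θ (Finsupp.single i 1) = θ i := by
  classical
  unfold lwt
  simp [Finsupp.single_apply]

omit [DecidableEq σ] in
/-- Linear weights commute with monomial substitutions. [folklore] -/
theorem lwt_piT {τ : Type*} [Fintype τ] (θ : τ → ℝ) (M : σ → (τ →₀ ℕ)) (L : σ →₀ ℕ) :
    lwt θ (piT M L) = lwt (fun i => lwt θ (M i)) L := by
  unfold lwt
  simp only [piT_apply]
  push_cast
  simp only [Finset.mul_sum, Finset.sum_mul]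
  rw [Finset.sum_comm]
  refine Finset.sum_congr rfl fun i _ => Finset.sum_congr rfl fun j _ => by ring

omit [Fintype σ] [DecidableEq σ] in
/-- The upstairs weight of a substituted letter is its planar weight. [folklore] -/
theorem RelData.lwt_theta_segM (ξ : Fin 2 → ℝ) (i : Fin (sE u v)) : lwt (D.theta ξ) (segM D.idx i) = rW ξ i := by
  have hrel := D.rW_rel ξ
  by_cases hia : i = D.idx.a
  · subst hia; rw [segM_a, lwt_add, lwt_single, lwt_single, D.theta_a, D.theta_c]; ring
  by_cases hib : i = D.idx.b
  · subst hib; rw [segM_b, lwt_add, lwt_single, lwt_single, D.theta_b, D.theta_d]; ring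
  by_cases hic : i = D.idx.c
  · subst hic; rw [segM_c, lwt_add, lwt_single, lwt_single, D.theta_a, D.theta_d]; ring
  by_cases hid : i = D.idx.d
  · subst hid; rw [segM_d, lwt_add, lwt_single, lwt_single, D.theta_b, D.theta_c]; linarith
  rw [segM_other D.idx i hia hib hic hid, lwt_single, D.theta_other ξ i hia hib hic hid]

omit [Fintype σ] [DecidableEq σ] in
/-- On toric images the upstairs weight is the planar weight of the push-forward. [folklore] -/
theorem RelData.lwt_theta_piT (ξ : Fin 2 → ℝ) (L : Fin (sE u v) →₀ ℕ) :
    lwt (D.theta ξ) (piT (segM D.idx) L) = -wt ξ (piE D.E' (piT (segM D.idx) L)) := by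
  rw [lwt_piT, D.piE_E'_piT, ← lwt_eq_neg_wt]
  congr 1
  funext i
  exact D.lwt_theta_segM ξ i

/-- The slice weights: `Γ` on `Z₁`, `B` on `Z₂`, `0` on `W₁, W₂`, `r_i` elsewhere — as the letters they are weights of. [folklore] -/
def RelData.swLetter (i : Fin (sE u v)) : Expo :=
  if i = D.idx.a then D.γ else if i = D.idx.c ∨ i = D.idx.d then 0 else enum u v i

omit [Fintype σ] [DecidableEq σ] in
/-- **The slice identity for upstairs weights.** For balanced `x`:
`θ(x) = Σ_i (-wt ξ (swLetter i)) · x̂_i + (A - Γ) · x_c`. [folklore] -/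
theorem RelData.lwt_theta_balanced (ξ : Fin 2 → ℝ) (x : Fin (sE u v) →₀ ℕ) (hx : Balanced D.idx x) :
    lwt (D.theta ξ) x = (∑ i, -wt ξ (D.swLetter i) * ((xhat D.idx x i : ℕ) : ℝ)) +
      (rW ξ D.idx.a - rW ξ D.idx.c) * ((x D.idx.c : ℕ) : ℝ) := by
  have F := And.intro D.idx.hab (And.intro D.idx.hac (And.intro D.idx.had (And.intro D.idx.hbc (And.intro D.idx.hbd D.idx.hcd))))
  unfold Balanced at hx
  have hxR : ((x D.idx.d : ℕ) : ℝ) = (x D.idx.a : ℝ) + (x D.idx.b : ℝ) - (x D.idx.c : ℝ) := by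
    have : ((x D.idx.a + x D.idx.b : ℕ) : ℝ) = ((x D.idx.c + x D.idx.d : ℕ) : ℝ) := by rw [hx]
    push_cast at this; linarith
  unfold lwt
  rw [sum_four_split D.idx, sum_four_split D.idx, xhat_a, xhat_b, xhat_c, xhat_d]
  have hrest : ∑ j ∈ rest D.idx, D.theta ξ j * ((x j : ℕ) : ℝ) =
      ∑ j ∈ rest D.idx, -wt ξ (D.swLetter j) * ((xhat D.idx x j : ℕ) : ℝ) := by
    refine Finset.sum_congr rfl fun j hj => ?_
    rw [mem_rest] at hj
    rw [xhat_other D.idx x j hj.2.2.1 hj.2.2.2]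
    unfold RelData.theta RelData.swLetter rW
    rw [if_neg hj.1, if_neg hj.2.1, if_neg hj.2.2.1, if_neg hj.2.2.2, if_neg hj.1, if_neg (not_or.mpr ⟨hj.2.2.1, hj.2.2.2⟩)]
  rw [hrest]
  have hsa : D.swLetter D.idx.a = D.γ := by unfold RelData.swLetter; rw [if_pos rfl]
  have hsb : D.swLetter D.idx.b = enum u v D.idx.b := by
    unfold RelData.swLetter; rw [if_neg F.1.symm, if_neg (not_or.mpr ⟨F.2.2.2.1, F.2.2.2.2.1⟩)]
  have hsc : D.swLetter D.idx.c = 0 := by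
    unfold RelData.swLetter; rw [if_neg F.2.1.symm, if_pos (Or.inl rfl)]
  have hsd : D.swLetter D.idx.d = 0 := by
    unfold RelData.swLetter; rw [if_neg F.2.2.1.symm, if_pos (Or.inr rfl)]
  rw [hsa, hsb, hsc, hsd, FormalLogLinearisation.wt_zero]
  rw [D.theta_a, D.theta_b, D.theta_c, D.theta_d, hxR]
  have hγ : -wt ξ D.γ = rW ξ D.idx.c := by unfold rW; rw [D.enum_c]
  have hβ : -wt ξ (enum u v D.idx.b) = rW ξ D.idx.b := rfl
  rw [hγ, hβ]
  push_cast
  ring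

end SegrePlanar

/-! ## Part T7: the slicing — per visible point; the count; the arithmetic; the law -/

section SegreCount
open Summit.ValiantsHypothesis.ValiantsHypothesis.Theorems.NewtonUnitEquations.TwoProducts.FormalLogLinearisation
open Summit.ValiantsHypothesis.ValiantsHypothesis.Theorems.NewtonUnitEquations.TwoProducts.PlanarCell

variable {m : ℕ} {u v : Fin m → MvPolynomial (Fin 2) ℂ} (D : RelData u v)

omit [Fintype σ] [DecidableEq σ] in
/-- **Per visible point.** A visible point `l` (valid `ξ`) yields a balanced toric point `x₀` over it with bad coordinate
`b = x₀(W₁) ≤ m`, whose reduced exponent `x̂₀` is a zero-avoiding STRICT minimiser of the slice functional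
`ν ↦ Σ_i (-wt ξ (swLetter i)) ν_i` on `{ν : F_b(ν) ≠ 0}` over ALL of `ℕ^s`. [folklore] -/
theorem RelData.sliceMin_of_visible (hu : ∀ j, coeff 0 (u j) = 0) (hv : ∀ j, coeff 0 (v j) = 0)
    (hinj : Set.InjOn (piE D.E') ↑D.GT.support) (ξ : Fin 2 → ℝ) (hval : ValidWeight u v ξ) (l : Expo)
    (htop : IsStrictTop ξ ↑(tailDiff u v).support l) :
    ∃ x₀ : Fin (sE u v) →₀ ℕ, piE D.E' x₀ = l ∧ Balanced D.idx x₀ ∧ x₀ D.idx.c ≤ m ∧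
      Fsl D.idx (cU u v) (cV u v) (x₀ D.idx.c) (xhat D.idx x₀) ≠ 0 ∧
      ∀ ν : Fin (sE u v) → ℕ, ν ≠ ⇑(xhat D.idx x₀) → Fsl D.idx (cU u v) (cV u v) (x₀ D.idx.c) ν ≠ 0 →
        ∑ i, -wt ξ (D.swLetter i) * ((xhat D.idx x₀ i : ℕ) : ℝ) < ∑ i, -wt ξ (D.swLetter i) * (ν i : ℝ) := by
  classical
  have _hu := hu; have _hv := hv
  obtain ⟨x₀, hx₀, hπ, hmin⟩ := D.lifted_of_visible hinj ξ l htop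
  obtain ⟨L₀, hL₀, hx₀L⟩ := D.exists_of_mem_support_GT x₀ hx₀
  have hbal : Balanced D.idx x₀ := hx₀L ▸ balanced_piT D.idx L₀
  have hdegL : deg L₀ ≤ m := deg_le_of_mem_support_liftG _ _ L₀ hL₀
  have hc_le : x₀ D.idx.c ≤ m := by
    rw [← hx₀L, piT_segM_c]
    have h := deg_eq_sum L₀
    rw [sum_four_split D.idx] at h
    omega
  -- the upstairs weights and their normalisation
  set θ : Fin (sE u v) → ℝ := D.theta ξ with hθdef
  have hθpos : ∀ i, 0 < θ i := D.theta_pos ξ hval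
  have hne : (Finset.univ : Finset (Fin (sE u v))).Nonempty := ⟨D.idx.a, Finset.mem_univ _⟩
  set θmin : ℝ := Finset.univ.inf' hne θ with hθmin
  have hθmin_pos : 0 < θmin := by
    obtain ⟨i, -, hi⟩ := Finset.exists_mem_eq_inf' hne θ
    rw [hθmin, hi]; exact hθpos i
  have hθmin_le : ∀ i, θmin ≤ θ i := fun i => Finset.inf'_le θ (Finset.mem_univ i)
  set θ' : Fin (sE u v) → ℝ := fun i => θ i / θmin with hθ'
  have hθ'1 : ∀ i, 1 ≤ θ' i := fun i => by
    rw [hθ']; simp only; rw [le_div_iff₀ hθmin_pos, one_mul]; exact hθmin_le i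
  have hlwt' : ∀ x : Fin (sE u v) →₀ ℕ, lwt θ' x = lwt θ x / θmin := fun x => by
    unfold lwt; rw [Finset.sum_div]
    refine Finset.sum_congr rfl fun i _ => ?_
    rw [hθ']; ring
  have hlwtG : ∀ x ∈ D.GT.support, lwt θ x = -wt ξ (piE D.E' x) := fun x hx => by
    obtain ⟨L, -, rfl⟩ := D.exists_of_mem_support_GT x hx
    exact D.lwt_theta_piT ξ L
  have hminθ' : x₀ ∈ (phiT (segM D.idx) (liftG (cU u v) (cV u v))).support ∧
      ∀ x ∈ (phiT (segM D.idx) (liftG (cU u v) (cV u v))).support, x ≠ x₀ → lwt θ' x₀ < lwt θ' x := by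
    refine ⟨hx₀, fun x hx hne' => ?_⟩
    rw [hlwt', hlwt']
    apply div_lt_div_of_pos_right _ hθmin_pos
    rw [hlwtG x₀ hx₀, hlwtG x hx, hπ]
    linarith [hmin x hx hne']
  have hA := toric_minLog (segM D.idx) (segM_ne_zero D.idx) θ' hθ'1 (cU u v) (cV u v) x₀ hminθ'
  set R : ℕ := ⌊lwt θ' x₀⌋₊ + 1 with hRdef
  have hRlt : lwt θ' x₀ < R := by rw [hRdef]; push_cast; exact Nat.lt_floor_add_one _
  -- degrees of `x₀`
  have hx₀ne : x₀ ≠ 0 := by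
    intro h0
    have := mem_support_iff.mp hx₀
    apply this
    rw [h0]
    unfold RelData.GT
    rw [phiT_liftG, coeff_sub,
      coeff_zero_prod_eq_one _ (fun j => coeff_zero_one_add_phiT_lin (segM D.idx) (segM_ne_zero D.idx) _),
      coeff_zero_prod_eq_one _ (fun j => coeff_zero_one_add_phiT_lin (segM D.idx) (segM_ne_zero D.idx) _), sub_self]
  have hdeg1 : 1 ≤ deg (xhat D.idx x₀) := by
    by_contra h0
    push Not at h0
    apply hx₀ne
    apply (deg_eq_zero_iff x₀).mp
    have h1 := deg_eq_deg_xhat_add D.idx x₀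
    have h2 := deg_xhat D.idx x₀
    unfold Balanced at hbal
    omega
  have hdegR : deg (xhat D.idx x₀) ≤ R := by
    have h1 := deg_eq_deg_xhat_add D.idx x₀
    have h2 : (deg x₀ : ℝ) ≤ lwt θ' x₀ := deg_le_lwt θ' hθ'1 x₀
    have h3 : (deg x₀ : ℝ) < R := lt_of_le_of_lt h2 hRlt
    have h4 : deg x₀ < R := by exact_mod_cast h3
    omega
  have hF0 : Fsl D.idx (cU u v) (cV u v) (x₀ D.idx.c) (xhat D.idx x₀) ≠ 0 :=
    (mem_support_segre_logTrunc_iff D.idx (cU u v) (cV u v) R x₀ hbal hdeg1 hdegR).mp hA.1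
  refine ⟨x₀, hπ, hbal, hc_le, hF0, fun ν hν hFν => ?_⟩
  obtain ⟨hνc, hνd, hbν⟩ := shape_of_Fsl_ne_zero D.idx (cU u v) (cV u v) _ ν hFν
  set x' : Fin (sE u v) →₀ ℕ := xOf D.idx (x₀ D.idx.c) ν with hx'def
  have hbal' : Balanced D.idx x' := xOf_balanced D.idx _ ν hbν
  have hxh' : ⇑(xhat D.idx x') = ν := xhat_xOf D.idx _ ν hνc hνd
  have hx'c : x' D.idx.c = x₀ D.idx.c := xOf_c D.idx _ ν
  have hne' : x' ≠ x₀ := by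
    intro h; apply hν; rw [← hxh', h]
  have hdeg1' : 1 ≤ deg (xhat D.idx x') := by
    by_contra h0
    push Not at h0
    have hz : xhat D.idx x' = 0 := (deg_eq_zero_iff _).mp (by omega)
    have hνz : ∀ j, ν j = 0 := fun j => by rw [← hxh', hz]; rfl
    have hb0 : x₀ D.idx.c = 0 := by have := hνz D.idx.a; have := hνz D.idx.b; omega
    apply hFν
    rw [hb0]; exact Fsl_zero_zero D.idx (cU u v) (cV u v) ν hνz
  have hlt' : lwt θ' x₀ < lwt θ' x' := by
    by_cases hR' : deg (xhat D.idx x') ≤ R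
    · have hmem : x' ∈ (phiT (segM D.idx) (logTrunc (cU u v) (cV u v) R)).support :=
        (mem_support_segre_logTrunc_iff D.idx (cU u v) (cV u v) R x' hbal' hdeg1' hR').mpr
          (by rw [hx'c, hxh']; exact hFν)
      exact hA.2 x' hmem hne'
    · push Not at hR'
      have h1 := deg_eq_deg_xhat_add D.idx x'
      have h2 : (deg x' : ℝ) ≤ lwt θ' x' := deg_le_lwt θ' hθ'1 x'
      have h3 : (R : ℝ) < deg (xhat D.idx x') := by exact_mod_cast hR'
      have h4 : (deg (xhat D.idx x') : ℝ) ≤ deg x' := by exact_mod_cast (by omega : deg (xhat D.idx x') ≤ deg x')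
      linarith
  have hlt : lwt θ x₀ < lwt θ x' := by
    have := hlt'
    rw [hlwt', hlwt'] at this
    exact (div_lt_div_iff_of_pos_right hθmin_pos).mp this
  rw [hθdef, D.lwt_theta_balanced ξ x₀ hbal, D.lwt_theta_balanced ξ x' hbal', hx'c] at hlt
  rw [hxh'] at hlt
  linarith

/-- The slice bound, uniform in `b ≤ m`. [folklore] -/
def sliceBd (A m s : ℕ) : ℕ :=
  (s + 2) ^ A * (2 * m * (m + 1) ^ 3 + 2) ^ (A * (Nat.log 2 (2 * m * (m + 1) ^ 3 + 2) + 1))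

omit [Fintype σ] [DecidableEq σ] in
/-- **The count for a non-degenerate four-term rank-one relation** (all four letters in the alphabet). [folklore] -/
theorem RelData.count {A : ℕ}
    (hA : ∀ (s : ℕ) (κ : Type) [Fintype κ] (C : κ → ℂ) (a : κ → Fin s → ℂ) (d : κ → Fin s → ℕ)
      (u v : Fin s → ℝ) (S : Finset (Fin s → ℕ)),
      (∀ μ ∈ S, bsum C a d μ ≠ 0 ∧ ∃ t : ℝ, ∀ ν : Fin s → ℕ, ν ≠ μ → bsum C a d ν ≠ 0 →
        ∑ i, (u i + t * v i) * (μ i : ℝ) < ∑ i, (u i + t * v i) * (ν i : ℝ)) →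
      S.card ≤ (s + 2) ^ A * (bwidth d + 2) ^ (A * (Nat.log 2 (bwidth d + 2) + 1)))
    (hu : ∀ j, coeff 0 (u j) = 0) (hv : ∀ j, coeff 0 (v j) = 0)
    (hR : RankOneCoincidences (fun j => (u j).support ∪ (v j).support)
      (Finsupp.single D.γ 1 + Finsupp.single D.δ 1) (Finsupp.single D.α 1 + Finsupp.single D.β 1))
    (S : Finset Expo) (hS : ∀ l ∈ S, ∃ ξ : Fin 2 → ℝ, ValidWeight u v ξ ∧ IsStrictTop ξ ↑(tailDiff u v).support l) :
    S.card ≤ (m + 1) * sliceBd A m (sE u v) := by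
  classical
  rcases S.eq_empty_or_nonempty with hSe | hSne
  · simp [hSe]
  obtain ⟨l₀, hl₀⟩ := hSne
  obtain ⟨ξ₀, hval₀, htop₀⟩ := hS l₀ hl₀
  have hTne : (tailSupport u v).Nonempty := tailSupport_nonempty_of_mem u v l₀ htop₀.1
  have hsE : 0 < sE u v := Finset.card_pos.mpr hTne
  set e₀ : Expo := enum u v ⟨0, hsE⟩ with he₀def
  have he₀ : e₀ ≠ 0 := enum_ne_zero u v hu hv _
  obtain ⟨β, τ, hpencil⟩ := pencil_param e₀ he₀
  have hinj := D.injOn_of_rankOne hu hv hR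
  -- choices along `S`
  have hξ : ∀ x : ↥S, ∃ ξ : Fin 2 → ℝ, ValidWeight u v ξ ∧ IsStrictTop ξ ↑(tailDiff u v).support x.1 :=
    fun x => hS x.1 x.2
  choose ξf hξval hξtop using hξ
  have hpt : ∀ x : ↥S, ∃ x₀ : Fin (sE u v) →₀ ℕ, piE D.E' x₀ = x.1 ∧ Balanced D.idx x₀ ∧ x₀ D.idx.c ≤ m ∧
      Fsl D.idx (cU u v) (cV u v) (x₀ D.idx.c) (xhat D.idx x₀) ≠ 0 ∧
      ∀ ν : Fin (sE u v) → ℕ, ν ≠ ⇑(xhat D.idx x₀) → Fsl D.idx (cU u v) (cV u v) (x₀ D.idx.c) ν ≠ 0 →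
        ∑ i, -wt (ξf x) (D.swLetter i) * ((xhat D.idx x₀ i : ℕ) : ℝ) < ∑ i, -wt (ξf x) (D.swLetter i) * (ν i : ℝ) :=
    fun x => D.sliceMin_of_visible hu hv hinj (ξf x) (hξval x) x.1 (hξtop x)
  choose xf hxπ hxbal hxc hxF hxmin using hpt
  -- normalisation radii and the pencil parameter
  have hrpos : ∀ x : ↥S, 0 < -wt (ξf x) e₀ := fun x => by
    linarith [wt_enum_neg u v (ξf x) (hξval x) ⟨0, hsE⟩]
  have hnorm : ∀ x : ↥S, wt (fun k => ξf x k / (-wt (ξf x) e₀)) e₀ = -1 := fun x => by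
    rw [wt_weight_div]
    have hne : wt (ξf x) e₀ ≠ 0 := by linarith [hrpos x]
    rw [div_neg, div_self hne]
  have hc : ∀ x : ↥S, ∃ c : ℝ, ∀ e : Expo, wt (fun k => ξf x k / (-wt (ξf x) e₀)) e = wt β e + c * wt τ e :=
    fun x => hpencil _ (hnorm x)
  choose cf hcf using hc
  set U : Fin (sE u v) → ℝ := fun i => -wt β (D.swLetter i) with hU
  set V : Fin (sE u v) → ℝ := fun i => -wt τ (D.swLetter i) with hV
  have hUV : ∀ (x : ↥S) (i : Fin (sE u v)),
      U i + cf x * V i = -wt (ξf x) (D.swLetter i) / (-wt (ξf x) e₀) := fun x i => by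
    have h := hcf x (D.swLetter i)
    rw [wt_weight_div] at h
    rw [hU, hV]
    simp only
    rw [neg_div, h]
    ring
  have hsumUV : ∀ (x : ↥S) (ν : Fin (sE u v) → ℕ), ∑ i, (U i + cf x * V i) * (ν i : ℝ) =
      (∑ i, -wt (ξf x) (D.swLetter i) * (ν i : ℝ)) / (-wt (ξf x) e₀) := fun x ν => by
    rw [Finset.sum_div]
    refine Finset.sum_congr rfl fun i _ => ?_
    rw [hUV x i]
    ring
  -- the key map `l ↦ (b, x̂₀)` is injective
  set key : ↥S → ℕ × (Fin (sE u v) → ℕ) := fun x => (xf x D.idx.c, ⇑(xhat D.idx (xf x))) with hkey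
  have hinjK : Function.Injective key := by
    intro x y h
    rw [hkey] at h
    simp only [Prod.mk.injEq] at h
    have hx : xf x = xf y := by
      rw [← xOf_xhat D.idx (xf x) (hxbal x), ← xOf_xhat D.idx (xf y) (hxbal y), h.1]
      exact congrArg _ h.2
    apply Subtype.ext
    rw [← hxπ x, ← hxπ y, hx]
  set Img : Finset (ℕ × (Fin (sE u v) → ℕ)) := (Finset.univ : Finset ↥S).image key with hImg
  have hcard : Img.card = S.card := by
    rw [hImg, Finset.card_image_of_injective _ hinjK, Finset.card_univ, Fintype.card_coe]
  have hfst : ∀ p ∈ Img, p.1 ∈ Finset.range (m + 1) := by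
    intro p hp
    obtain ⟨x, -, rfl⟩ := Finset.mem_image.mp hp
    exact Finset.mem_range.mpr (Nat.lt_succ_of_le (hxc x))
  have hfib : ∀ b ∈ Finset.range (m + 1), (Img.filter fun p => p.1 = b).card ≤ sliceBd A m (sE u v) := by
    intro b hb
    have hbm : b ≤ m := Nat.lt_succ_iff.mp (Finset.mem_range.mp hb)
    set Sb : Finset (Fin (sE u v) → ℕ) := (Img.filter fun p => p.1 = b).image Prod.snd with hSb
    have hcardb : (Img.filter fun p => p.1 = b).card = Sb.card := by
      rw [hSb, Finset.card_image_of_injOn]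
      intro p hp q hq hpq
      have hp' := (Finset.mem_filter.mp (Finset.mem_coe.mp hp)).2
      have hq' := (Finset.mem_filter.mp (Finset.mem_coe.mp hq)).2
      exact Prod.ext (hp'.trans hq'.symm) hpq
    rw [hcardb]
    have hhyp : ∀ μ ∈ Sb,
        bsum (termC D.idx (cU u v) (cV u v) b) (termA D.idx (cU u v) (cV u v) b) (termD D.idx b) μ ≠ 0 ∧
        ∃ t : ℝ, ∀ ν : Fin (sE u v) → ℕ, ν ≠ μ →
          bsum (termC D.idx (cU u v) (cV u v) b) (termA D.idx (cU u v) (cV u v) b) (termD D.idx b) ν ≠ 0 →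
            ∑ i, (U i + t * V i) * (μ i : ℝ) < ∑ i, (U i + t * V i) * (ν i : ℝ) := by
      intro μ hμ
      obtain ⟨p, hp, rfl⟩ := Finset.mem_image.mp hμ
      obtain ⟨hpI, hpb⟩ := Finset.mem_filter.mp hp
      obtain ⟨x, -, rfl⟩ := Finset.mem_image.mp hpI
      rw [hkey] at hpb ⊢
      simp only at hpb ⊢
      refine ⟨?_, cf x, fun ν hν hFν => ?_⟩
      · have := hxF x
        unfold Fsl at this
        rw [hpb] at this
        exact this
      · have hFν' : Fsl D.idx (cU u v) (cV u v) (xf x D.idx.c) ν ≠ 0 := by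
          unfold Fsl; rw [hpb]; exact hFν
        have hlt := hxmin x ν hν hFν'
        rw [hsumUV x, hsumUV x ν]
        exact div_lt_div_of_pos_right hlt (hrpos x)
    have hwidth : bwidth (termD D.idx b : SIdx m b → Fin (sE u v) → ℕ) ≤ 2 * m * (m + 1) ^ 3 :=
      (bwidth_termD_le D.idx b).trans (Nat.mul_le_mul_left _ (Nat.pow_le_pow_left (by omega) 3))
    calc Sb.card ≤ (sE u v + 2) ^ A * (bwidth (termD D.idx b : SIdx m b → Fin (sE u v) → ℕ) + 2) ^
          (A * (Nat.log 2 (bwidth (termD D.idx b : SIdx m b → Fin (sE u v) → ℕ) + 2) + 1)) :=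
          hA (sE u v) (SIdx m b) _ _ _ U V Sb hhyp
      _ ≤ sliceBd A m (sE u v) := toolBound_mono _ _ hwidth
  rw [← hcard, Finset.card_eq_sum_card_fiberwise hfst]
  calc ∑ b ∈ Finset.range (m + 1), (Img.filter fun p => p.1 = b).card
      ≤ ∑ b ∈ Finset.range (m + 1), sliceBd A m (sE u v) := Finset.sum_le_sum hfib
    _ = (m + 1) * sliceBd A m (sE u v) := by rw [Finset.sum_const, Finset.card_range, smul_eq_mul]

omit [Fintype σ] [DecidableEq σ] in
/-- **Arithmetic**: `(m+1) · sliceBd ≤ 2^{c m} (s+2)^c` and `2^{13m}(s+2)^2 ≤ 2^{c m}(s+2)^c` with `c = 212A + 13`. [folklore] -/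
theorem arith_R6 (A : ℕ) : ∃ c : ℕ,
    (∀ m s : ℕ, 1 ≤ m → (m + 1) * sliceBd A m s ≤ 2 ^ (c * m) * (s + 2) ^ c) ∧
    (∀ m s : ℕ, 2 ^ (13 * m) * (s + 2) ^ 2 ≤ 2 ^ (c * m) * (s + 2) ^ c) := by
  refine ⟨212 * A + 13, fun m s hm => ?_, fun m s => ?_⟩
  · set p : ℕ := Nat.log 2 (m + 1) with hp
    have hp1 : m + 1 < 2 ^ (p + 1) := Nat.lt_pow_succ_log_self (by norm_num) (m + 1)
    have hp2 : 2 ^ p ≤ m + 1 := Nat.pow_log_le_self 2 (by omega)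
    have hpp : p < 2 ^ p := Nat.lt_two_pow_self
    have hp3 : p * p ≤ 2 ^ (p + 1) := sq_le_two_pow_succ p
    have h2p : 2 ^ (p + 1) = 2 * 2 ^ p := pow_succ' 2 p
    set N : ℕ := 2 * m * (m + 1) ^ 3 with hN
    have h3 : 1 ≤ (m + 1) ^ 3 := Nat.one_le_pow _ _ (by omega)
    have hN1 : N + 2 ≤ 2 * (m + 1) ^ 4 := by
      have e1 : N + 2 = 2 * (m * (m + 1) ^ 3 + 1) := by rw [hN]; ring
      have e2 : (m + 1) ^ 4 = m * (m + 1) ^ 3 + (m + 1) ^ 3 := by ring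
      rw [e1, e2]
      omega
    have hN2 : N + 2 < 2 ^ (4 * p + 5) := by
      have h4 : (m + 1) ^ 4 < (2 ^ (p + 1)) ^ 4 := Nat.pow_lt_pow_left hp1 (by norm_num)
      have e3 : 2 * (2 ^ (p + 1)) ^ 4 = 2 ^ (4 * p + 5) := by
        rw [← pow_mul, ← pow_succ']
        congr 1
        ring
      calc N + 2 ≤ 2 * (m + 1) ^ 4 := hN1
        _ < 2 * (2 ^ (p + 1)) ^ 4 := by omega
        _ = 2 ^ (4 * p + 5) := e3
    have hL : Nat.log 2 (N + 2) + 1 ≤ 4 * p + 5 := by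
      have := Nat.log_lt_of_lt_pow (by omega : N + 2 ≠ 0) hN2
      omega
    have hq : (4 * p + 5) * (4 * p + 5) ≤ 194 * m := by
      have e4 : (4 * p + 5) * (4 * p + 5) = 16 * (p * p) + 40 * p + 25 := by ring
      rw [e4]
      have hone : 1 ≤ 2 ^ p := Nat.one_le_two_pow
      omega
    have hpow1 : (N + 2) ^ (A * (Nat.log 2 (N + 2) + 1)) ≤ 2 ^ (194 * A * m) := by
      calc (N + 2) ^ (A * (Nat.log 2 (N + 2) + 1))
          ≤ (2 ^ (4 * p + 5)) ^ (A * (Nat.log 2 (N + 2) + 1)) := Nat.pow_le_pow_left hN2.le _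
        _ ≤ (2 ^ (4 * p + 5)) ^ (A * (4 * p + 5)) :=
            Nat.pow_le_pow_right (by positivity) (Nat.mul_le_mul_left _ hL)
        _ = 2 ^ (A * ((4 * p + 5) * (4 * p + 5))) := by rw [← pow_mul]; congr 1; ring
        _ ≤ 2 ^ (194 * A * m) := Nat.pow_le_pow_right (by norm_num) (by
            calc A * ((4 * p + 5) * (4 * p + 5)) ≤ A * (194 * m) := Nat.mul_le_mul_left _ hq
              _ = 194 * A * m := by ring)
    have hm1 : m + 1 ≤ 2 ^ m := Nat.lt_two_pow_self
    have hsA : (s + 2) ^ A ≤ (s + 2) ^ (212 * A + 13) := Nat.pow_le_pow_right (by omega) (by omega)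
    have hexp : m + 194 * A * m ≤ (212 * A + 13) * m := by nlinarith [Nat.zero_le (A * m)]
    calc (m + 1) * sliceBd A m s = (m + 1) * ((s + 2) ^ A * (N + 2) ^ (A * (Nat.log 2 (N + 2) + 1))) := by
          rw [hN]; rfl
      _ ≤ 2 ^ m * ((s + 2) ^ (212 * A + 13) * 2 ^ (194 * A * m)) :=
          Nat.mul_le_mul hm1 (Nat.mul_le_mul hsA hpow1)
      _ = 2 ^ (m + 194 * A * m) * (s + 2) ^ (212 * A + 13) := by rw [pow_add]; ring
      _ ≤ 2 ^ ((212 * A + 13) * m) * (s + 2) ^ (212 * A + 13) :=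
          Nat.mul_le_mul_right _ (Nat.pow_le_pow_right (by norm_num) hexp)
  · have hexp : 13 * m ≤ (212 * A + 13) * m := by nlinarith [Nat.zero_le (A * m)]
    exact Nat.mul_le_mul (Nat.pow_le_pow_right (by norm_num) hexp) (Nat.pow_le_pow_right (by omega) (by omega))

/-- **R6 — the four-term rank-one law.** If ALL additive coincidences of the letter family come from ONE four-term relation
`α + β = γ + δ` among distinct letters (rank-one coincidence lattice), then GLOBALLY `#visible ≤ 2^{c m} (#T + 2)^c`.
[folklore] -/
def RankOneFourLaw : Prop :=
  ∃ c : ℕ, ∀ (m : ℕ) (u v : Fin m → MvPolynomial (Fin 2) ℂ), (∀ j, coeff 0 (u j) = 0) → (∀ j, coeff 0 (v j) = 0) →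
    (∃ α β γ δ : Expo, α ≠ β ∧ α ≠ γ ∧ α ≠ δ ∧ β ≠ γ ∧ β ≠ δ ∧ γ ≠ δ ∧ α + β = γ + δ ∧
      RankOneCoincidences (fun j => (u j).support ∪ (v j).support)
        (Finsupp.single γ 1 + Finsupp.single δ 1) (Finsupp.single α 1 + Finsupp.single β 1)) →
    ∀ S : Finset Expo, (∀ l ∈ S, ∃ ξ : Fin 2 → ℝ, ValidWeight u v ξ ∧ IsStrictTop ξ ↑(tailDiff u v).support l) →
      S.card ≤ 2 ^ (c * m) * ((tailSupport u v).card + 2) ^ c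

omit [Fintype σ] [DecidableEq σ] in
/-- **THE PROVED SPLIT `BinExpPencilCount → RankOneFourLaw`** (R6 rung of the relation ladder; Segre lift + toric Lemma A +
`b`-slicing + the binomial-exponential pencil count). [folklore] -/
theorem rankOneFourLaw_of_binExpPencilCount (hT : BinExpPencilCount) : RankOneFourLaw := by
  classical
  obtain ⟨A, hA⟩ := binExpPencilCount_fintype hT
  obtain ⟨c, hc1, hc2⟩ := arith_R6 A
  refine ⟨c, fun m u v hu hv hrel S hS => ?_⟩
  obtain ⟨α, β, γ, δ, hab, hac, had, hbc, hbd, hcd, hrel, hR⟩ := hrel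
  rcases S.eq_empty_or_nonempty with hSe | hSne
  · simp [hSe]
  obtain ⟨l₀, hl₀⟩ := hSne
  obtain ⟨ξ₀, hval₀, htop₀⟩ := hS l₀ hl₀
  have hm : 1 ≤ m := by
    rcases Nat.eq_zero_or_pos m with h | h
    · exfalso
      subst h
      apply mem_support_iff.mp htop₀.1
      unfold tailDiff
      simp
    · exact h
  by_cases hall : α ∈ tailSupport u v ∧ β ∈ tailSupport u v ∧ γ ∈ tailSupport u v ∧ δ ∈ tailSupport u v
  · obtain ⟨hα, hβ, hγ, hδ⟩ := hall
    let D : RelData u v := ⟨α, β, γ, δ, hα, hβ, hγ, hδ, hab, hac, had, hbc, hbd, hcd, hrel⟩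
    have h := (D.count hA hu hv hR S hS).trans (hc1 m (sE u v) hm)
    exact h
  · have hex : ∃ e : Expo, (e = α ∨ e = β ∨ e = γ ∨ e = δ) ∧ e ∉ tailSupport u v := by
      simp only [not_and_or] at hall
      rcases hall with h | h | h | h
      exacts [⟨α, Or.inl rfl, h⟩, ⟨β, Or.inr (Or.inl rfl), h⟩, ⟨γ, Or.inr (Or.inr (Or.inl rfl)), h⟩,
        ⟨δ, Or.inr (Or.inr (Or.inr rfl)), h⟩]
    obtain ⟨e, he, hnot⟩ := hex
    have hnotj : ∀ j, e ∉ (u j).support ∪ (v j).support := by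
      intro j hj
      apply hnot
      rcases Finset.mem_union.mp hj with h | h
      · exact support_u_subset u v j h
      · exact support_v_subset u v j h
    have hperm : PermType (fun j => (u j).support ∪ (v j).support) :=
      permType_of_absent_letter _ α β γ δ hab hac had hbc hbd hcd hR e he hnotj
    calc S.card ≤ 2 ^ (13 * m) * ((tailSupport u v).card + 2) ^ 2 := permTypeLaw_proof m u v hu hv hperm S hS
      _ ≤ 2 ^ (c * m) * ((tailSupport u v).card + 2) ^ c := hc2 m _

end SegreCount
end Summit.ValiantsHypothesis.ValiantsHypothesis.Theorems.NewtonUnitEquations.TwoProducts.PermutationType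

end
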